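import Summits.NavierStokesRegularity.NavierStokesRegularity.Theses.ExtremiserTransience
import Summits.NavierStokesRegularity.NavierStokesRegularity.Theorems.ExtremiserTransienceNearExtremalTransienceDSSLogMean
import Summits.NavierStokesRegularity.NavierStokesRegularity.Theorems.ExtremiserTransienceNearExtremalTransienceSharpConstant
import Summits.NavierStokesRegularity.NavierStokesRegularity.Theorems.ExtremiserTransienceNearExtremalTransienceExtremiserLiouvilleConstantSpeedAxialDossier
import Summits.NavierStokesRegularity.NavierStokesRegularity.Theorems.ExtremiserTransienceNearExtremalTransienceExtremiserLiouvilleConstantSpeedL2LiouvilleGeneral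
import Summits.NavierStokesRegularity.NavierStokesRegularity.Theorems.ExtremiserTransienceNearExtremalTransienceExtremiserLiouvilleConstantSpeedMultiplierExtension
import Literature.Analysis.FluidPDE.BlowupAncientSolution
import Literature.Analysis.FluidPDE.NSBoundedMildOseen
import Literature.Analysis.FluidPDE.MildSolution
import Literature.Analysis.FluidPDE.BarkerPrange2020VorticityAlignmentTypeIHolds
import HarnessLib.Audit

/-!
# LINE g7-3 «l2_budget» — crux `ExtremiserTransience.NearExtremalTransience` (stmt-NavierStokesRegularity-21883)

Ideator seat ns-idea-10 (D-0145, generation 7, lens «rescuer»).  TARGET (concluded BY NAME by `NearExtremalTransience_of`):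
`Summit.NavierStokesRegularity.NavierStokesRegularity.Theses.ExtremiserTransience.NearExtremalTransience`.  No summit is proved by a
line; K1b is NOT proved here; nothing here proves NS regularity.

## The corpse and the dodge

Line B (`Lines/extremiser_liouville.lean`) reduces the crux to K2 (persistence compactness), K1a (analytic slices) and K1b (no analytic
constant-speed extremiser = no RESIDUE OBJECT).  The K1b seat (ns-el-k1b g2–g6) has proved, for every residue object `(w, c, M)` taken in
the axial frame, a finite KKT multiplier `μ` with the Euler–Lagrange identity, EXACT MASS `M²μ(ℝ³) = S²`, ZERO BARYCENTRE `b = ∫w dμ = 0`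
(`…ConstantSpeedBarycentreZero`), and the reduction `stub_noAnalyticExtremal_of_noAxialResidueObject` (`…ConstantSpeedAxialDossier`);
and, since g3, the `L²` FLUX LIOUVILLE THEOREM `eq_farField_of_constSpeed_of_sq_integrable`: a constant-speed divergence-free field with
`w − c ∈ L²(ℝ³)` is the constant `c`.  Its recorded wall (k1b_jet.md §6–§8): «exclude tails of `w − c` between `|x|⁻¹` and `|x|^{-3/2}`» /
«the annular Caccioppoli estimate for the rescaled E–L system».

THE DODGE (new lever: the LOW-FREQUENCY BUDGET).  Write `V = w − c`, `S = Jst w`, `Z = Zen w`, `W = Wpa w`.  The weak Euler–Lagrange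
identity for solenoidal tests says, as distributions modulo gradients,
  `κ⋆²M²(ZΔ² − WΔ)V = ℙ(S·G − wμ)`,  `G := curl((Dw + Dwᵀ)ω) − div(ω ⊗ ω)`  (first derivatives of `L¹` tensors, `ω = curl w`),
so on `{k ≠ 0}` the Fourier transform of `V` IS A FUNCTION:
  `V̂(k) = ℙ(k)·(S·Ĝ(k) − (wμ)^(k)) / (κ⋆²M²|k|²(W + Z|k|²))`,   `|Ĝ(k)| ≤ |k|·‖τ‖_{L¹}`,   `(wμ)^(0) = b = 0`.
High frequencies are harmless (`|k|⁻⁶`); at LOW FREQUENCY `|V̂(k)|² ≲ (S²‖τ‖₁²|k|² + M²ψ(|k|)²)/|k|⁴` with the modulus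
`ψ(κ) := ∫ min(2, κ‖y‖) dμ(y)` of `(wμ)^` at `0` (this is where `b = 0` enters).  By Minkowski,
`(∫₀¹ ψ(κ)²κ⁻² dκ)^{1/2} ≤ 2∫‖y‖^{1/2} dμ(y)`: **`V ∈ L²(ℝ³)` as soon as the multiplier has a finite HALF-MOMENT**, in particular as soon
as the TAIL LAW `s·μ{‖y‖ > s} → 0` holds (`∫‖y‖^{1/2}dμ = ∫₀^∞ μ{‖y‖ > t²}dt < ∞`).  The polynomial ambiguity at `k = 0` is killed by
`V ∈ L⁶` (tree).  Then the `L²` Liouville theorem ends the residue object: no FLAT slab (infinite slab energy) and no JET (window energies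
`≡ E₀ > 0`) can have `V ∈ L²`.  So the window `(|x|⁻¹, |x|^{-3/2})` of the K1b record is closed NOT by a decay estimate on `V` but by a decay
estimate on the MULTIPLIER: through the E–L equation at low frequency, a tail `V ~ |x|^{-a}` (`1 < a < 3/2`) forces the fat multiplier tail
`μ{‖y‖ > r} ~ r^{1−a}`, and the tail law forbids it.

THE TAIL LAW comes from the PAIRING ROUTE of LINE g7-1 rev 2 (`Lines/kernel_budget_signlaw.lean`, target T6): test the E–L identity with the
explicit bounded solenoidal fields `K_s = ℙ(ψ_h ĉ)(·/s)` (`h ≥ 0` radial on `1 ≤ ‖y‖ ≤ 2`, `ψ_h = Δ⁻¹h`), for which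
`A1(K_s) = (2M)⁻¹ s⁻² ∫ h(x/s)‖V‖² ≥ 0` EXACTLY (constant speed: `V_ĉ = −‖V‖²/2M`), `|S·J1(K_s)| + κ⋆²M²Z|C1(K_s)| = o(1/s)` from the `L²`
tails of `ω, Dw, ∇ω`, and the `μ`-side equals `M∫ w(y/s) dμ + O(sup_{‖y‖≥s}‖V‖·μ{‖y‖ ≥ s})` with the EXPLICIT weight
`w = 2m₀/3 + K_ĉ ≥ 0`, `w ≥ 0.3125·(2m₀/3)` beyond `4s` (thin-shell formula `6πt·w = 1 − ¾u(1+γ) − ¼u³(1−3γ)`, `u = t/‖y‖`, `γ = cos²∠(y,ĉ)`,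
decreasing in `u`, vanishing at `u = 1`); whence `t(4s) ≤ o(1) + ½t(s)` for `t(s) = s·μ{‖y‖ ≥ s}`.  The fields `K_s` are `O(‖x‖⁻¹)` with
BOUNDED (not decaying) vector potential, one order outside the K1b seat's `multiplierIdentity_curl_of_decay`; their admissibility is E — PROVED
in this file (rev 1.1): `multiplierIdentity_curl_of_boundedPotential`.

## Registered stubs (2 new + line B's K2, K1a verbatim) and what is PROVED here (E is a theorem since rev 1.1)

* E · PROVED `boundedPotentialIdentity_holds : Sig.StubE` — the E–L identity for `curl A`, `A` smooth BOUNDED with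
  `‖DᵏA‖ ≤ C(1+‖x‖)^{-k}`, `k = 1,2,3`: `multiplierIdentity_curl_of_boundedPotential` (port of the tree's `multiplierIdentity_curl_of_decay`
  with the graded envelopes `norm_iteratedFDeriv_cutoff_smul_le_of_bounded`; sorry-free).
* T · `stub_tailLaw : Sig.StubT` (M) — the tail bound `s·μ{‖y‖ > s} ≤ C` (rev 1.2: the weakest form F needs; the pairing route gives
  `→ 0` = T6 of LINE g7-1) from E by the pairing route above with CRUDE `O(1/s)` bounds on `J1, C1`.
* F · `stub_fourierBudget : Sig.StubF` (M mathematically; L/XL in Lean: tempered distributions, Plancherel) — the low-frequency budget: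
  residue package ∧ `b = 0` ∧ tail `O(1/s)` ⇒ `∫‖w − c‖² < ∞` (physical-space form of the key step: `‖Γ(· − y) − Γ‖_{L²(ℝ³)} = c‖y‖^{1/2}`
  for the Newton kernel, so the Newton potential of a zero-mass measure with finite half-moment is in `L²` by Minkowski; partial fractions
  `1/(|k|²(W + Z|k|²)) = W⁻¹(|k|⁻² − (|k|² + W/Z)⁻¹)` split `V` into Newton and Yukawa parts).
* K2 · `stub_extremalPersistenceCompactness` — line B's, verbatim (shared with LINES g7-1, g7-2).  K1a `analyticSlices` is PROVED here since
  rev 1.4 (ns-idea-10 g8, 2026-08-29: Lemarié-Rieusset local analyticity + bounded Oseen-mild uniqueness; std axioms; was `stub_analyticSlices`).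
* PROVED (sorry-free): E (above); `noAxialResidueObject_of : Sig.StubE → Sig.StubT → Sig.StubF → (hypothesis of the axial dossier)` via the tree's
  `eq_farField_of_constSpeed_of_sq_integrable`; `noAnalyticExtremal` (= K1b, line B's `stub_noAnalyticExtremal` statement verbatim) via
  `stub_noAnalyticExtremal_of_noAxialResidueObject`; `extremalAncient_false_of`; the composition `NearExtremalTransience_of`.

Relation to LINES g7-1/g7-2: g7-1's residual `B ∧ C` (no conduit jet, no flat slab) is SUPERSEDED by F if F holds (both alternatives die at
once through `L²`); g7-1's `Lines/kernel_budget_signlaw.lean` keeps the typed pairing-route targets (T6 = T here, T8, T9 = E here); g7-2 is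
independent (dynamic side).  Cheapest falsifier of the line: stub E on the single field `K = ℙ(ψ_h ĉ)` (if the identity failed for it, T
dies); cheapest falsifier of F: exhibit a finite measure `μ` with `b = 0`, `s·μ{‖y‖>s} → 0` and `L¹` tensors `τ` for which
`ℙ(k)(ik·τ̂ − (wμ)^)/(|k|²(W + Z|k|²)) ∉ L²` — impossible by the displayed bound, so F can only fail at the tempered-distribution
bookkeeping (`V̂ =` that function on `{k ≠ 0}`), which uses `div V = 0`, `V ∈ L⁶`, `μ` finite and de Rham only. [folklore]

## rev 1.4 (2026-08-29, ns-idea-10 g8): K1a PROVED (`analyticSlices`, ≈ 70 lines); statements UNCHANGED (def-diff: `stub_analyticSlices` removed /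
theorem added with the same statement; one new import `Literature.Analysis.FluidPDE.BarkerPrange2020VorticityAlignmentTypeIHolds`).
-/

noncomputable section

open Set Filter Topology MeasureTheory Metric Function
open scoped ENNReal NNReal Topology InnerProductSpace RealInnerProductSpace ContDiff Laplacian
open Literature.Analysis.FluidPDE Literature.Analysis

namespace Summit.NavierStokesRegularity.NavierStokesRegularity.Cruxes.NearExtremalTransience.L2Budget

open Summit.NavierStokesRegularity.NavierStokesRegularity.Theses.ExtremiserTransience
open Summit.NavierStokesRegularity.NavierStokesRegularity.Theorems
open Summit.NavierStokesRegularity.NavierStokesRegularity.Theorems.DepletionLadder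
open Summit.NavierStokesRegularity.NavierStokesRegularity.Theorems.DepletionLadder.KStar
open Summit.NavierStokesRegularity.NavierStokesRegularity.Theorems.DepletionLadder.KStar.HalfSpace
open Summit.NavierStokesRegularity.NavierStokesRegularity.Theorems.RungReynoldsOne.WeightedSlice

set_option linter.unusedVariables false
set_option linter.dupNamespace false
set_option linter.style.longLine false

/-! ## The axial residue package (= the binders of `ExtremiserLiouville.stub_noAnalyticExtremal_of_noAxialResidueObject` up to `b = 0`) -/

/-- The AXIAL RESIDUE PACKAGE: a K1b residue object `(w, c, M)` in the axial frame `c = (0,0,c₂)` together with its KKT multiplier `μ`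
(finite, exact mass, Euler–Lagrange identity on solenoidal `C_c^∞` tests, zero barycentre).  Every field is a THEOREM about any residue
object (K1b seat g2–g6); the bundle is exactly the list of binders of the axial dossier, minus its last three (Stokeslet law, blow-down
vorticity, flat-or-jet), which this line does not use. -/
def IsAxialResidue (w : E3 → E3) (c : E3) (M : ℝ) (μ : Measure E3) : Prop :=
  AnalyticOnNhd ℝ w Set.univ ∧ ContDiff ℝ (⊤ : ℕ∞) w ∧ VectorCalculus.IsDivFree w ∧ (∃ B : ℝ, ∀ x, ‖fderiv ℝ w x‖ ≤ B) ∧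
  (∫⁻ x, ‖iteratedFDeriv ℝ 1 w x‖ₑ ^ 2 < ⊤) ∧ (∫⁻ x, ‖iteratedFDeriv ℝ 2 w x‖ₑ ^ 2 < ⊤) ∧ (∀ x, ‖w x‖ = M) ∧ 0 < M ∧
  c 0 = 0 ∧ c 1 = 0 ∧ c 2 ≠ 0 ∧ ‖c‖ = M ∧ Tendsto (fun x => w x - c) (cocompact E3) (𝓝 0) ∧ MemLp (fun x => w x - c) 6 volume ∧
  0 < M * Real.sqrt (Zen w) * Real.sqrt (Wpa w) ∧ kStar * M * Real.sqrt (Zen w) * Real.sqrt (Wpa w) = |Jst w| ∧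
  IsFiniteMeasure μ ∧ M ^ 2 * μ.real univ = Jst w ^ 2 ∧
  (∀ φ : E3 → E3, ContDiff ℝ ∞ φ → HasCompactSupport φ → VectorCalculus.IsDivFree φ →
    Jst w * J1 w φ - kStar ^ 2 * M ^ 2 * (Wpa w * A1 w φ + Zen w * C1 w φ) = ∫ x, ⟪w x, φ x⟫_ℝ ∂μ) ∧
  (∫ x, w x ∂μ) = 0

/-- The Euler–Lagrange identity on the BOUNDED-POTENTIAL test class: `φ = curl A`, `A` smooth and bounded with
`‖DᵏA(x)‖ ≤ C(1+‖x‖)^{−k}` for `k = 1,2,3` (so `φ = O(‖x‖⁻¹)`, `Dφ = O(‖x‖⁻²)`, `D curl φ = O(‖x‖⁻³)`).  One order slower than the tree's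
`ExtremiserLiouville.multiplierIdentity_curl_of_decay` (`‖A‖ ≤ C(1+‖x‖)⁻¹`, `‖DᵏA‖ ≤ C(1+‖x‖)⁻²`). -/
def BoundedPotentialIdentity (w : E3 → E3) (M : ℝ) (μ : Measure E3) : Prop :=
  ∀ (A : E3 → E3), ContDiff ℝ ∞ A → ∀ C : ℝ, (∀ x, ‖A x‖ ≤ C) →
    (∀ k : ℕ, 1 ≤ k → k ≤ 3 → ∀ x, ‖iteratedFDeriv ℝ k A x‖ ≤ C * ((1 + ‖x‖) ^ k)⁻¹) →
    Jst w * J1 w (curl A) - kStar ^ 2 * M ^ 2 * (Wpa w * A1 w (curl A) + Zen w * C1 w (curl A)) = ∫ x, ⟪w x, curl A x⟫_ℝ ∂μ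

/-! ## The three new stubs (named signatures) -/

namespace Sig

/-- Signature of stub E (`stub_boundedPotentialIdentity`): every axial residue package satisfies the E–L identity on the
bounded-potential class. -/
def StubE : Prop :=
  ∀ (w : E3 → E3) (c : E3) (M : ℝ) (μ : Measure E3), IsAxialResidue w c M μ → BoundedPotentialIdentity w M μ

/-- Signature of stub T (`stub_tailLaw`, rev 1.2: the WEAKEST form F needs): the multiplier of an axial residue package with the
bounded-potential identity has tail `μ{‖y‖ > s} = O(1/s)` (`s ≥ 1`).  (The pairing route gives `o(1/s)`; `O` is all the budget uses, and
its derivation needs no tail-smallness of `ω, Dw` — only `‖ω‖₂, ‖Dw‖₂ < ∞`, `w − c → 0` at infinity, `b = 0` and `A1(K_s) ≥ 0`.) -/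
def StubT : Prop :=
  ∀ (w : E3 → E3) (c : E3) (M : ℝ) (μ : Measure E3), IsAxialResidue w c M μ → BoundedPotentialIdentity w M μ →
    ∃ C : ℝ, ∀ s : ℝ, 1 ≤ s → s * μ.real {x : E3 | s < ‖x‖} ≤ C

/-- Signature of stub F (`stub_fourierBudget`): an axial residue package (zero barycentre!) whose multiplier has tail `O(1/s)` has
square-integrable excess velocity `w − c` (the budget needs only `∫‖y‖^{1/2}dμ < ∞`, i.e. any tail `O(s^{-1/2-δ})`). -/
def StubF : Prop :=
  ∀ (w : E3 → E3) (c : E3) (M : ℝ) (μ : Measure E3), IsAxialResidue w c M μ →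
    (∃ C : ℝ, ∀ s : ℝ, 1 ≤ s → s * μ.real {x : E3 | s < ‖x‖} ≤ C) → Integrable (fun x => ‖w x - c‖ ^ 2) volume

end Sig

/-! ## E is PROVED: the multiplier identity on the bounded-potential class (port of the tree's `multiplierIdentity_curl_of_decay`
with GRADED truncation envelopes — order 1 bounded, orders 2 and 3 below `K(1+‖x‖)⁻²`) -/

section StubE
open Summit.NavierStokesRegularity.NavierStokesRegularity.Theorems.ExtremiserLiouville

variable {A v : E3 → E3}

/-- GRADED truncation envelopes on the bounded-potential class: if `‖A‖ ≤ C` and `‖DᵏA(x)‖ ≤ C(1+‖x‖)^{-k}` (`k = 1,2,3`), then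
`‖Dᵏ(χ_ρ A)(x)‖ ≤ 8cC·(1+‖x‖)^{-k}` for `k ≤ 3`, uniformly in `ρ ≥ 1` (Leibniz + `‖Dⁱχ_ρ‖ ≤ c(1+‖x‖)^{-i}`; every term has total
weight exactly `k`).  Variant of the tree's `norm_iteratedFDeriv_cutoff_smul_le` (class `‖A‖ ≲ (1+‖x‖)⁻¹`, `‖DᵏA‖ ≲ (1+‖x‖)⁻²`). [folklore] -/
theorem norm_iteratedFDeriv_cutoff_smul_le_of_bounded (hA : ContDiff ℝ ∞ A) {C : ℝ}
    (hA0 : ∀ x, ‖A x‖ ≤ C)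
    (hAk : ∀ k : ℕ, 1 ≤ k → k ≤ 3 → ∀ x, ‖iteratedFDeriv ℝ k A x‖ ≤ C * ((1 + ‖x‖) ^ k)⁻¹)
    {c : ℝ} (hc1 : 1 ≤ c)
    (hc : ∀ ρ : ℝ, 1 ≤ ρ → ∀ i : ℕ, i ≤ 3 → ∀ x : E3, ‖iteratedFDeriv ℝ i (cutoff (E := E3) ρ) x‖ ≤ c * ((1 + ‖x‖) ^ i)⁻¹)
    {ρ : ℝ} (hρ : 1 ≤ ρ) {k : ℕ} (hk3 : k ≤ 3) (x : E3) :
    ‖iteratedFDeriv ℝ k (fun y => cutoff ρ y • A y) x‖ ≤ 8 * c * C * ((1 + ‖x‖) ^ k)⁻¹ := by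
  have hC0 : 0 ≤ C := (norm_nonneg _).trans (hA0 0)
  have hc0 : 0 < c := by linarith
  have ht : 1 ≤ 1 + ‖x‖ := by linarith [norm_nonneg x]
  set t : ℝ := 1 + ‖x‖ with htdef
  have ht0 : 0 < t := by positivity
  have hAj : ∀ j : ℕ, j ≤ 3 → ‖iteratedFDeriv ℝ j A x‖ ≤ C * (t ^ j)⁻¹ := by
    intro j hj
    rcases Nat.eq_zero_or_pos j with h0 | hpos
    · subst h0
      rw [norm_iteratedFDeriv_zero, pow_zero, inv_one, mul_one]
      exact hA0 x
    · exact hAk j hpos hj x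
  have hle := norm_iteratedFDeriv_smul_le (contDiff_cutoff ρ : ContDiff ℝ ∞ (cutoff (E := E3) ρ)) hA x (n := k)
    (by exact_mod_cast le_top)
  refine hle.trans ?_
  have hterm : ∀ i ∈ Finset.range (k + 1),
      (k.choose i : ℝ) * ‖iteratedFDeriv ℝ i (cutoff ρ) x‖ * ‖iteratedFDeriv ℝ (k - i) A x‖ ≤
        (k.choose i : ℝ) * (c * C * (t ^ k)⁻¹) := by
    intro i hi
    have hik : i ≤ k := Nat.lt_succ_iff.1 (Finset.mem_range.1 hi)
    have hi3 : i ≤ 3 := hik.trans hk3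
    have h1 := hc ρ hρ i hi3 x
    have h2 := hAj (k - i) (by omega)
    have h3 : (t ^ i)⁻¹ * (t ^ (k - i))⁻¹ = (t ^ k)⁻¹ := by
      rw [← mul_inv, ← pow_add, Nat.add_sub_cancel' hik]
    rw [mul_assoc]
    refine mul_le_mul_of_nonneg_left ?_ (by positivity)
    calc ‖iteratedFDeriv ℝ i (cutoff ρ) x‖ * ‖iteratedFDeriv ℝ (k - i) A x‖
        ≤ (c * (t ^ i)⁻¹) * (C * (t ^ (k - i))⁻¹) :=
          mul_le_mul h1 h2 (norm_nonneg _) (by positivity)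
      _ = c * C * ((t ^ i)⁻¹ * (t ^ (k - i))⁻¹) := by ring
      _ = c * C * (t ^ k)⁻¹ := by rw [h3]
  refine (Finset.sum_le_sum hterm).trans ?_
  rw [← Finset.sum_mul]
  have hsum : ∑ i ∈ Finset.range (k + 1), (k.choose i : ℝ) = 2 ^ k := by
    have h := Nat.sum_range_choose k
    exact_mod_cast h
  rw [hsum]
  have h2k : (2 : ℝ) ^ k ≤ 8 := by
    interval_cases k <;> norm_num
  have : 0 ≤ c * C * (t ^ k)⁻¹ := by positivity
  nlinarith [h2k, this]

/-- **The multiplier identity for solenoidal test fields `φ = curl A` with BOUNDED potential**: `v` smooth, `‖v‖ ≡ M`, `D¹v, D²v ∈ L²`,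
`μ` finite with the multiplier identity on smooth compactly supported divergence-free tests; `A ∈ C^∞` with `‖A‖ ≤ C` and
`‖DᵏA(x)‖ ≤ C(1+‖x‖)^{-k}` (`k = 1,2,3`).  Then `S·J₁(curl A) − κ⋆²M²(W a₁(curl A) + Z c₁(curl A)) = ∫⟪v, curl A⟫dμ`.
Proof = the tree's `multiplierIdentity_curl_of_decay` verbatim (solenoidal truncations `curl(χ_ρ A)`, dominated convergence in the four
integrals) with the graded envelopes above: order 1 bounded (test field bounded against the finite `μ`), orders 2, 3 below `K(1+‖x‖)⁻²`
(square integrable; `curl`, `D`, `D curl` of the truncations against `ω, Dv, ∇ω ∈ L²`). [folklore] -/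
theorem multiplierIdentity_curl_of_boundedPotential (hv : ContDiff ℝ ∞ v) {M : ℝ} (hM : ∀ x, ‖v x‖ = M)
    (h1 : ∫⁻ x, ‖iteratedFDeriv ℝ 1 v x‖ₑ ^ 2 < ⊤) (h2 : ∫⁻ x, ‖iteratedFDeriv ℝ 2 v x‖ₑ ^ 2 < ⊤)
    (μ : Measure E3) [IsFiniteMeasure μ]
    (hμ : ∀ φ : E3 → E3, ContDiff ℝ ∞ φ → HasCompactSupport φ → VectorCalculus.IsDivFree φ →
      Jst v * J1 v φ - kStar ^ 2 * M ^ 2 * (Wpa v * A1 v φ + Zen v * C1 v φ) = ∫ x, ⟪v x, φ x⟫_ℝ ∂μ)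
    (hA : ContDiff ℝ ∞ A) {C : ℝ} (hA0 : ∀ x, ‖A x‖ ≤ C)
    (hAk : ∀ k : ℕ, 1 ≤ k → k ≤ 3 → ∀ x, ‖iteratedFDeriv ℝ k A x‖ ≤ C * ((1 + ‖x‖) ^ k)⁻¹) :
    Jst v * J1 v (curl A) - kStar ^ 2 * M ^ 2 * (Wpa v * A1 v (curl A) + Zen v * C1 v (curl A)) =
      ∫ x, ⟪v x, curl A x⟫_ℝ ∂μ := by
  obtain ⟨c, hc1, hc⟩ := exists_norm_iteratedFDeriv_cutoff_le
  have hC0 : 0 ≤ C := (norm_nonneg _).trans (hA0 0)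
  set κ : ℝ := ‖curlCLM‖ with hκ
  have hκ0 : 0 ≤ κ := by rw [hκ]; exact norm_nonneg curlCLM
  set K : ℝ := 8 * c * C with hK
  have hK0 : 0 ≤ K := by positivity
  set B₁ : ℝ := (1 + κ) ^ 2 * K with hB₁
  have hB₁0 : 0 ≤ B₁ := by positivity
  have hκB : κ * K ≤ B₁ := by rw [hB₁]; nlinarith [hκ0, hK0]
  have hκ2B : κ * (κ * K) ≤ B₁ := by rw [hB₁]; nlinarith [hκ0, hK0]
  -- the envelope
  set E : E3 → ℝ := fun x => ((1 + ‖x‖) ^ 2)⁻¹ with hE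
  have hE0 : ∀ x, 0 ≤ E x := fun x => by positivity
  have hE1 : ∀ x, E x ≤ 1 := fun x => by
    rw [hE]; exact inv_le_one_of_one_le₀ (one_le_pow₀ (by linarith [norm_nonneg x]))
  have hEi : Integrable (fun x => E x ^ 2) volume := integrable_inv_one_add_norm_sq_sq
  -- the truncations
  set T : ℕ → E3 → E3 := fun n y => cutoff ((n : ℝ) + 1) y • A y with hT
  set φ : ℕ → E3 → E3 := fun n => curl (T n) with hφ
  have hρ1 : ∀ n : ℕ, (1 : ℝ) ≤ (n : ℝ) + 1 := fun n => by simp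
  have hρ0 : ∀ n : ℕ, (0 : ℝ) < (n : ℝ) + 1 := fun n => by positivity
  have hTs : ∀ n, ContDiff ℝ ∞ (T n) := fun n => (contDiff_cutoff _).smul hA
  have hTc : ∀ n, HasCompactSupport (T n) := fun n => (hasCompactSupport_cutoff (hρ0 n)).smul_right
  have hφs : ∀ n, ContDiff ℝ ∞ (φ n) := fun n => contDiff_curl (n := ⊤) (by exact_mod_cast hTs n)
  have hφc : ∀ n, HasCompactSupport (φ n) := fun n => hasCompactSupport_curl (hTc n)
  have hφdiv : ∀ n, VectorCalculus.IsDivFree (φ n) := fun n x =>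
    divergence_curl_eq_zero_holds (T n) ((hTs n).of_le (by norm_cast)) x
  have hid : ∀ n, Jst v * J1 v (φ n) - kStar ^ 2 * M ^ 2 * (Wpa v * A1 v (φ n) + Zen v * C1 v (φ n)) =
      ∫ x, ⟪v x, φ n x⟫_ℝ ∂μ := fun n => hμ (φ n) (hφs n) (hφc n) (hφdiv n)
  -- envelopes of the truncations
  have henvk : ∀ n, ∀ k : ℕ, k ≤ 3 → ∀ x, ‖iteratedFDeriv ℝ k (T n) x‖ ≤ K * ((1 + ‖x‖) ^ k)⁻¹ :=
    fun n k hk3 x => norm_iteratedFDeriv_cutoff_smul_le_of_bounded hA hA0 hAk hc1 hc (hρ1 n) hk3 x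
  have ht1 : ∀ x : E3, 1 ≤ 1 + ‖x‖ := fun x => by linarith [norm_nonneg x]
  -- graded envelopes ⇒ the tree's shapes: order 1 bounded, orders 2 and 3 below `K·E`
  have henv1 : ∀ n x, ‖iteratedFDeriv ℝ 1 (T n) x‖ ≤ K := fun n x => by
    refine (henvk n 1 (by norm_num) x).trans ?_
    have : ((1 + ‖x‖) ^ 1)⁻¹ ≤ 1 := inv_le_one_of_one_le₀ (by rw [pow_one]; exact ht1 x)
    exact mul_le_of_le_one_right hK0 this
  have henv : ∀ n, ∀ k : ℕ, 2 ≤ k → k ≤ 3 → ∀ x, ‖iteratedFDeriv ℝ k (T n) x‖ ≤ K * E x := fun n k hk2 hk3 x => by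
    refine (henvk n k hk3 x).trans (mul_le_mul_of_nonneg_left ?_ hK0)
    rw [hE]
    exact inv_pow_le_inv_sq (ht1 x) hk2
  have hb0 : ∀ n x, ‖φ n x‖ ≤ B₁ := fun n x => by
    have h := norm_iteratedFDeriv_curl_le (hTs n) 0 x
    rw [norm_iteratedFDeriv_zero] at h
    calc ‖φ n x‖ ≤ κ * ‖iteratedFDeriv ℝ 1 (T n) x‖ := h
      _ ≤ κ * K := mul_le_mul_of_nonneg_left (henv1 n x) hκ0
      _ ≤ B₁ := hκB
  have hb1 : ∀ n x, ‖fderiv ℝ (φ n) x‖ ≤ B₁ * E x := fun n x => by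
    have h := norm_iteratedFDeriv_curl_le (hTs n) 1 x
    rw [← norm_fderiv_eq_norm_iteratedFDeriv_one] at h
    calc ‖fderiv ℝ (φ n) x‖ ≤ κ * ‖iteratedFDeriv ℝ 2 (T n) x‖ := h
      _ ≤ κ * (K * E x) := mul_le_mul_of_nonneg_left (henv n 2 le_rfl (by norm_num) x) hκ0
      _ = (κ * K) * E x := by ring
      _ ≤ B₁ * E x := mul_le_mul_of_nonneg_right hκB (hE0 x)
  have hb2 : ∀ n x, ‖curl (φ n) x‖ ≤ B₁ * E x := fun n x => by
    have h := norm_iteratedFDeriv_curl_le (hφs n) 0 x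
    rw [norm_iteratedFDeriv_zero] at h
    have h' := norm_iteratedFDeriv_curl_le (hTs n) 1 x
    calc ‖curl (φ n) x‖ ≤ κ * ‖iteratedFDeriv ℝ 1 (φ n) x‖ := h
      _ ≤ κ * (κ * ‖iteratedFDeriv ℝ 2 (T n) x‖) := mul_le_mul_of_nonneg_left h' hκ0
      _ ≤ κ * (κ * (K * E x)) :=
          mul_le_mul_of_nonneg_left (mul_le_mul_of_nonneg_left (henv n 2 le_rfl (by norm_num) x) hκ0) hκ0
      _ = (κ * (κ * K)) * E x := by ring
      _ ≤ B₁ * E x := mul_le_mul_of_nonneg_right hκ2B (hE0 x)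
  have hb3 : ∀ n x, ‖fderiv ℝ (curl (φ n)) x‖ ≤ B₁ * E x := fun n x => by
    have h := norm_iteratedFDeriv_curl_le (hφs n) 1 x
    rw [← norm_fderiv_eq_norm_iteratedFDeriv_one] at h
    have h' := norm_iteratedFDeriv_curl_le (hTs n) 2 x
    calc ‖fderiv ℝ (curl (φ n)) x‖ ≤ κ * ‖iteratedFDeriv ℝ 2 (φ n) x‖ := h
      _ ≤ κ * (κ * ‖iteratedFDeriv ℝ 3 (T n) x‖) := mul_le_mul_of_nonneg_left h' hκ0
      _ ≤ κ * (κ * (K * E x)) :=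
          mul_le_mul_of_nonneg_left (mul_le_mul_of_nonneg_left (henv n 3 (by norm_num) le_rfl x) hκ0) hκ0
      _ = (κ * (κ * K)) * E x := by ring
      _ ≤ B₁ * E x := mul_le_mul_of_nonneg_right hκ2B (hE0 x)
  -- local agreement: eventually in `n`, `φ n`, `curl (φ n)`, `D(φ n)`, `D curl(φ n)` at `x` are those of `curl A`
  have hloc : ∀ x : E3, ∀ᶠ n : ℕ in atTop, φ n x = curl A x ∧ curl (φ n) x = curl (curl A) x ∧
      fderiv ℝ (φ n) x = fderiv ℝ (curl A) x ∧ fderiv ℝ (curl (φ n)) x = fderiv ℝ (curl (curl A)) x := by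
    intro x
    filter_upwards [tendsto_natCast_atTop_atTop.eventually_gt_atTop ‖x‖] with n hn
    set U : Set E3 := ball (0 : E3) ((n : ℝ) + 1) with hU
    have hUo : IsOpen U := isOpen_ball
    have hxU : x ∈ U := by rw [hU, mem_ball_zero_iff]; linarith
    have hTA : EqOn (T n) A U := fun y hy => by
      have hy' : ‖y‖ ≤ (n : ℝ) + 1 := (mem_ball_zero_iff.1 hy).le
      show cutoff ((n : ℝ) + 1) y • A y = A y
      rw [cutoff_eq_one (hρ0 n) hy', one_smul]
    obtain ⟨-, hφA⟩ := eqOn_fderiv_curl_of_isOpen hUo hTA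
    obtain ⟨hDφ, hcφ⟩ := eqOn_fderiv_curl_of_isOpen hUo hφA
    obtain ⟨hDcφ, -⟩ := eqOn_fderiv_curl_of_isOpen hUo hcφ
    exact ⟨hφA hxU, hcφ hxU, hDφ hxU, hDcφ hxU⟩
  -- integrability of the three global densities of `v`
  have IZ : Integrable (fun x => ‖curl v x‖ ^ 2) volume := (integrable_norm_curl_sq (hv.of_le (by norm_cast)) h1).1
  have IW : Integrable (fun x => frobeniusNormSq (fderiv ℝ (curl v) x)) volume :=
    (integrable_frobeniusNormSq_fderiv_curl (hv.of_le (by norm_cast)) h2).1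
  have ID : Integrable (fun x => ‖fderiv ℝ v x‖ ^ 2) volume := by
    have h1' : ∫⁻ x, ‖fderiv ℝ v x‖ₑ ^ 2 < ⊤ := by
      refine lt_of_le_of_lt (le_of_eq (lintegral_congr fun x => ?_)) h1
      rw [← ofReal_norm, ← ofReal_norm, norm_iteratedFDeriv_one]
    exact integrable_sq_norm_of_lintegral_lt_top (hv.continuous_fderiv (by simp)) h1'
  -- continuity facts
  have hcv : Continuous (curl v) := continuous_curl (hv.of_le (by norm_cast))
  have hDv : Continuous (fderiv ℝ v) := hv.continuous_fderiv (by simp)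
  have hDcv : Continuous (fderiv ℝ (curl v)) :=
    (contDiff_curl (n := ⊤) (by exact_mod_cast hv)).continuous_fderiv (by simp)
  have hcφn : ∀ n, Continuous (curl (φ n)) := fun n => continuous_curl ((hφs n).of_le (by norm_cast))
  have hDφn : ∀ n, Continuous (fderiv ℝ (φ n)) := fun n => (hφs n).continuous_fderiv (by simp)
  have hDcφn : ∀ n, Continuous (fderiv ℝ (curl (φ n))) := fun n =>
    (contDiff_curl (n := ⊤) (by exact_mod_cast hφs n)).continuous_fderiv (by simp)
  -- (L1) the `J₁` integrals
  have LJ : Tendsto (fun n => J1 v (φ n)) atTop (𝓝 (J1 v (curl A))) := by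
    unfold J1
    refine tendsto_integral_of_dominated_convergence (fun x => B₁ * (‖fderiv ℝ v x‖ ^ 2 + 2 * ‖curl v x‖ ^ 2))
      (fun n => ?_) ((ID.add (IZ.const_mul 2)).const_mul B₁) (fun n => Eventually.of_forall fun x => ?_) ?_
    · exact ((((hcφn n).inner (hDv.clm_apply hcv)).add (hcv.inner ((hDφn n).clm_apply hcv))).add
        (hcv.inner (hDv.clm_apply (hcφn n)))).aestronglyMeasurable
    · set a := ‖fderiv ℝ v x‖ with ha_def
      set b := ‖curl v x‖ with hb_def
      have ha : 0 ≤ a := norm_nonneg _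
      have hb : 0 ≤ b := norm_nonneg _
      have hBE : B₁ * E x ≤ B₁ := by nlinarith [hE1 x, hB₁0]
      have hcφ : ‖curl (φ n) x‖ ≤ B₁ := (hb2 n x).trans hBE
      have hDφ : ‖fderiv ℝ (φ n) x‖ ≤ B₁ := (hb1 n x).trans hBE
      rw [Real.norm_eq_abs]
      have t1 : |⟪curl (φ n) x, fderiv ℝ v x (curl v x)⟫| ≤ B₁ * (a * b) := by
        refine (abs_real_inner_le_norm _ _).trans ?_
        exact mul_le_mul hcφ ((fderiv ℝ v x).le_opNorm _) (norm_nonneg _) hB₁0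
      have t2 : |⟪curl v x, fderiv ℝ (φ n) x (curl v x)⟫| ≤ B₁ * (b * b) := by
        refine (abs_real_inner_le_norm _ _).trans ?_
        calc ‖curl v x‖ * ‖fderiv ℝ (φ n) x (curl v x)‖ ≤ b * (B₁ * b) :=
              mul_le_mul_of_nonneg_left (((fderiv ℝ (φ n) x).le_opNorm _).trans (mul_le_mul_of_nonneg_right hDφ hb)) hb
          _ = B₁ * (b * b) := by ring
      have t3 : |⟪curl v x, fderiv ℝ v x (curl (φ n) x)⟫| ≤ B₁ * (a * b) := by
        refine (abs_real_inner_le_norm _ _).trans ?_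
        calc ‖curl v x‖ * ‖fderiv ℝ v x (curl (φ n) x)‖ ≤ b * (a * B₁) :=
              mul_le_mul_of_nonneg_left (((fderiv ℝ v x).le_opNorm _).trans (mul_le_mul_of_nonneg_left hcφ ha)) hb
          _ = B₁ * (a * b) := by ring
      have hsum := (abs_add_le _ _).trans (add_le_add ((abs_add_le _ _).trans (add_le_add t1 t2)) t3)
      have hab : 2 * (a * b) + b * b ≤ a ^ 2 + 2 * b ^ 2 := by nlinarith [two_mul_le_add_sq a b]
      calc |⟪curl (φ n) x, fderiv ℝ v x (curl v x)⟫ + ⟪curl v x, fderiv ℝ (φ n) x (curl v x)⟫ +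
            ⟪curl v x, fderiv ℝ v x (curl (φ n) x)⟫|
          ≤ B₁ * (a * b) + B₁ * (b * b) + B₁ * (a * b) := hsum
        _ = B₁ * (2 * (a * b) + b * b) := by ring
        _ ≤ B₁ * (a ^ 2 + 2 * b ^ 2) := mul_le_mul_of_nonneg_left hab hB₁0
    · refine Eventually.of_forall fun x => tendsto_const_nhds.congr' ?_
      filter_upwards [hloc x] with n hn
      rw [hn.2.1, hn.2.2.1]
  -- (L2) the `a₁` integrals
  have LA : Tendsto (fun n => A1 v (φ n)) atTop (𝓝 (A1 v (curl A))) := by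
    unfold A1
    refine tendsto_integral_of_dominated_convergence (fun x => (‖curl v x‖ ^ 2 + (B₁ * E x) ^ 2) / 2)
      (fun n => ?_) ((IZ.add ((hEi.const_mul (B₁ ^ 2)).congr (Eventually.of_forall fun x => by ring))).div_const 2)
      (fun n => Eventually.of_forall fun x => ?_) ?_
    · exact (hcv.inner (hcφn n)).aestronglyMeasurable
    · rw [Real.norm_eq_abs]
      refine (abs_real_inner_le_norm _ _).trans ?_
      have h := hb2 n x
      nlinarith [sq_nonneg (‖curl v x‖ - B₁ * E x), norm_nonneg (curl v x), norm_nonneg (curl (φ n) x)]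
    · refine Eventually.of_forall fun x => tendsto_const_nhds.congr' ?_
      filter_upwards [hloc x] with n hn
      rw [hn.2.1]
  -- (L3) the `c₁` integrals
  have LC : Tendsto (fun n => C1 v (φ n)) atTop (𝓝 (C1 v (curl A))) := by
    unfold C1
    refine tendsto_integral_of_dominated_convergence
      (fun x => 1 / 2 * frobeniusNormSq (fderiv ℝ (curl v) x) + 1 / (2 * 1) * (3 * (B₁ * E x) ^ 2))
      (fun n => ?_) ((IW.const_mul _).add (((hEi.const_mul (3 * B₁ ^ 2)).congr
        (Eventually.of_forall fun x => by ring)).const_mul _))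
      (fun n => Eventually.of_forall fun x => ?_) ?_
    · exact (continuous_finsetSum _ fun i _ =>
        (hDcv.clm_apply continuous_const).inner ((hDcφn n).clm_apply continuous_const)).aestronglyMeasurable
    · rw [Real.norm_eq_abs]
      refine (sum_inner_le_frobeniusNormSq (fderiv ℝ (curl v) x) (fderiv ℝ (curl (φ n)) x) one_pos).trans
        (add_le_add le_rfl (mul_le_mul_of_nonneg_left ?_ (by norm_num)))
      refine (BradshawTsai2017.frobeniusNormSq_le_three_mul_norm_sq _).trans ?_
      have h := hb3 n x
      have h0 : 0 ≤ ‖fderiv ℝ (curl (φ n)) x‖ := norm_nonneg _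
      nlinarith [h, h0]
    · refine Eventually.of_forall fun x => tendsto_const_nhds.congr' ?_
      filter_upwards [hloc x] with n hn
      rw [hn.2.2.2]
  -- (L4) the multiplier side
  have Lμ : Tendsto (fun n => ∫ x, ⟪v x, φ n x⟫_ℝ ∂μ) atTop (𝓝 (∫ x, ⟪v x, curl A x⟫_ℝ ∂μ)) := by
    refine tendsto_integral_of_dominated_convergence (fun _ => M * B₁)
      (fun n => ?_) (integrable_const _) (fun n => Eventually.of_forall fun x => ?_) ?_
    · exact (hv.continuous.inner (hφs n).continuous).aestronglyMeasurable
    · rw [Real.norm_eq_abs]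
      refine (abs_real_inner_le_norm _ _).trans ?_
      rw [hM x]
      exact mul_le_mul_of_nonneg_left (hb0 n x) (by rw [← hM x]; exact norm_nonneg _)
    · refine Eventually.of_forall fun x => tendsto_const_nhds.congr' ?_
      filter_upwards [hloc x] with n hn
      rw [hn.1]
  -- pass to the limit in the identity
  have Llhs : Tendsto (fun n => Jst v * J1 v (φ n) - kStar ^ 2 * M ^ 2 * (Wpa v * A1 v (φ n) + Zen v * C1 v (φ n)))
      atTop (𝓝 (Jst v * J1 v (curl A) - kStar ^ 2 * M ^ 2 * (Wpa v * A1 v (curl A) + Zen v * C1 v (curl A)))) :=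
    (LJ.const_mul _).sub (((LA.const_mul _).add (LC.const_mul _)).const_mul _)
  have e : (fun n => Jst v * J1 v (φ n) - kStar ^ 2 * M ^ 2 * (Wpa v * A1 v (φ n) + Zen v * C1 v (φ n))) =
      fun n => ∫ x, ⟪v x, φ n x⟫_ℝ ∂μ := funext hid
  rw [e] at Llhs
  exact tendsto_nhds_unique Llhs Lμ

end StubE

/-- **E · PROVED (was `stub_boundedPotentialIdentity`, M).**  Every axial residue package satisfies the E–L identity on the
bounded-potential class `φ = curl A`, `‖A‖ ≤ C`, `‖DᵏA‖ ≤ C(1+‖x‖)^{-k}` (`k ≤ 3`) — by `multiplierIdentity_curl_of_boundedPotential`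
above (sorry-free).  This is also target T9 `target_multiplierIdentity_decayOne` of LINE g7-1's `Lines/kernel_budget_signlaw.lean`
(same statement over `IsResiduePackage`). -/
theorem boundedPotentialIdentity_holds : Sig.StubE := by
  intro w c M μ hP A hA C hA0 hAk
  obtain ⟨han, hcd, hdiv, hB, h1, h2, hM, hMpos, hc0, hc1, hc2, hcM, hfar, hL6, hpos, heq, hfin, hmass, hμ, hb⟩ := hP
  haveI := hfin
  exact multiplierIdentity_curl_of_boundedPotential hcd hM h1 h2 μ hμ hA hA0 hAk

/-- **T · stub_tailLaw (M; the load-bearing analytic stub; rev 1.2 = bounded form).**  `s·μ{‖y‖ > s} ≤ C` (`s ≥ 1`) for the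
multiplier of every axial residue package, by the PAIRING ROUTE (module docstring; LINE g7-1 `Lines/kernel_budget_signlaw.lean` T6): the
explicit tests `K_s = ℙ(ψ_h ĉ)(·/s) = curl(s·(ĉ × ∇Ψ)(·/s))` are admissible by E (PROVED above: bounded potential `ĉ × ∇Ψ`,
`‖Dᵏ‖ ≲ (1+‖x‖)^{-k}`); `A1(K_s) = (2M)⁻¹s⁻²∫h(x/s)‖w − c‖² ≥ 0` EXACTLY (`V_ĉ = −‖V‖²/2M` from `‖w‖ = ‖c‖ = M`); CRUDE bounds suffice:
`|J1(K_s)| ≤ s⁻¹‖DK‖_∞·3(‖Dw‖₂ + ‖ω‖₂)‖ω‖₂`, `|C1(K_s)| = s⁻³|∫⟪ω, (∇h × ĉ)(x/s)⟫| ≤ s^{-3/2}‖∇h‖_∞|A₁|^{1/2}‖ω‖₂` (`curl ΔK = ∇h × ĉ`);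
the `μ`-side equals `M∫_{‖y‖≥s} w(y/s)dμ + O(η(s)μ{‖y‖ ≥ s})`, `η(s) = 2 sup_{‖y‖≥s}‖w − c‖·‖K‖_∞ → 0`, with the weight
`w = 2/3 + K_ĉ = (2/3)·f(s/‖y‖, cos²∠(y,ĉ)) ≥ 0`, `≥ (2/3)(5/8)` beyond `4s` (unit-shell normalisation: `K_ĉ = −(1+γ)/(2r) + (3γ−1)/(6r³)`
outside, `−2/3` inside; `f` certified sorry-free in `Lines/kernel_budget_weight.lean`; uses `b_ĉ = 0` from the package to cancel the interior
constant); hence `(5/12)M·μ{‖y‖ ≥ 4s} ≤ C₁/s + C₂η(s)μ{‖y‖ ≥ s}`, i.e. `u(4s) ≤ 4C₁' + 4C₂'η(s)u(s)` for `u(s) = sμ{‖y‖ ≥ s}`, which with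
`η → 0` and monotonicity of `μ{‖y‖ ≥ s}` bounds `u`.  (The sharper `o(1/s)` — T6 of LINE g7-1 — additionally uses that `DK_s`, `curl K_s` vanish
on `B_s`, so only `L²` tails enter; not needed here.)  DECOMPOSED in `Lines/l2_budget_tail.lean` (rev 1.3): `stubT_of_targets :
target_tailKit → target_muSide → Sig.StubT` is PROVED there (identity E on the rescaled potentials via `rescale_boundedPotential`, energy
bookkeeping, `ε = Mκ/(2Λ)`, `scale_iteration`), leaving T-i = the explicit-field package (a TAIL KIT: `A` in E's class, `K = curl A` constant on
`B₁`, weight `⟪K − K(0), e⟫ ≥ 0` with floor, and `A1 ≥ 0`, `J1, C1 = O(1/s)` against constant-speed fields) and T-v = the μ-side estimate;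
sorry-free joints also in `Lines/l2_budget_glue.lean` (`scale_iteration`, `integrable_sqrt_norm_of_tail`, `rescale_boundedPotential`).  Why it
might fail: only in the explicit-field bookkeeping (third re-derivation of the shell formula recorded in the card; `A1` integration by parts
against the decaying `V ∈ L⁶` with `Dw ∈ L²`). [folklore] -/
theorem stub_tailLaw : Sig.StubT := by
  sorry

/-- **F · stub_fourierBudget (the LOW-FREQUENCY BUDGET; M mathematically, L/XL in Lean: tempered distributions — the Literature library's
`𝓢'`/`toTemperedDistribution` API, e.g. `FourierSobolevNormProofs`, covers part).**  For an axial residue package with multiplier tail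
`O(1/s)`, `∫‖w − c‖² < ∞`.  Route (module docstring), with NO pressure and NO de Rham: (1) the distribution
`T := κ⋆²M²(WΔV − ZΔ²V) + S·G − wμ` (`V = w − c ∈ L⁶`, `G = curl((Dw+Dwᵀ)ω) − div(ω⊗ω)` = first derivatives of `L¹` tensors, `μ` finite)
is TEMPERED and the package identity says `⟨T, φ⟩ = 0` for solenoidal `φ ∈ C_c^∞`; testing with `φ = curl ψ` gives `curl T = 0` in `𝒮′`,
i.e. `k × T̂ = 0`; (2) on the open set `{k ≠ 0}`: `T̂ ∥ k`, so `ℙ(k)T̂ = 0`, and `k·V̂ = 0` (`div V = 0`) gives `ℙ(k)V̂ = V̂`; hence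
`κ⋆²M²|k|²(W + Z|k|²)·V̂ = ℙ(k)F̂` there, with `F̂ = S·Ĝ − (wμ)^` a CONTINUOUS function, `|Ĝ(k)| ≤ |k|·‖τ‖_{L¹}`,
`|(wμ)^(k)| = |(wμ)^(k) − b| ≤ M·ψ(|k|)`, `ψ(κ) := ∫ min(2, κ‖y‖) dμ(y)` (this is where `b = ∫w dμ = 0` enters); so `V̂|_{k≠0}` is the
function `U(k) := ℙ(k)F̂(k)/(κ⋆²M²|k|²(W + Z|k|²))`; (3) `U ∈ L²(ℝ³)`: `∫_{|k|>1}|U|² ≲ ∫₁^∞ (κ² + 1)κ⁻⁸κ² dκ < ∞` and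
`∫_{|k|<1}|U|² ≲ ∫₀¹ (S²‖τ‖₁²κ² + M²ψ(κ)²)κ⁻⁴κ² dκ ≤ S²‖τ‖₁²/… + M²∫₀¹ψ²κ⁻²dκ`, where by Minkowski
`(∫₀^∞ ψ(κ)²κ⁻² dκ)^{1/2} ≤ ∫ ‖min(2κ⁻¹, ‖y‖)‖_{L²(dκ)} dμ(y) = 2∫‖y‖^{1/2} dμ(y) = 2∫₀^∞ μ{‖y‖ > t²} dt ≤ 2μ(ℝ³) + 2∫₁^∞ μ{‖y‖ > t²}dt < ∞`
by the tail law (`μ{‖y‖ > s} ≤ C/s`; in fact `O(s^{-1/2-δ})` would do); (4) `V̂ − U` is a tempered distribution supported in `{0}`, so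
`V − Ǔ` is a polynomial lying in `L⁶ + L²`, hence `0`; thus `V = Ǔ ∈ L²`.  Why it might fail: not at (2)–(3) (explicit inequalities,
checked); only in the bookkeeping — that the tree's `J1`, `A1`, `C1` are `⟨G,φ⟩`, `⟨−ΔV,φ⟩ = ∫⟪curl w, curl φ⟫`, `⟨Δ²V,φ⟩ = ∫⟪∇ω, ∇curl φ⟫`
on solenoidal tests (they are, by the definitions in `…KStarAttainedHalfSpaceVariation`), and the Lean cost of tempered distributions /
«support `{0}` ⇒ polynomial».  Analogy of record: for steady exterior flow the velocity defect has finite Dirichlet/kinetic budget exactly when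
the net force vanishes and the leading far-field term is (fundamental tensor)·(net force) (Finn 1965, Babenko 1973;
[corpus:book:maleknd-mathematical-theory-fluid-mechanics p.72]); here `(−Δ)(−WΔ+ZΔ²)`… replaces the Oseen operator, the KKT multiplier
replaces the body force, and `b = 0` (K1b seat, `integral_barycentre_eq_zero_of_memLp`) is «zero net force». [folklore] 
V90 PRICES (rev 1.2).  P1 (step 1, `curl T = 0` in `𝒮′`, CHOICE = the `𝒮`-extension, and it is ALREADY COVERED): a Schwartz potential
`ψ ∈ 𝒮(ℝ³)³` is bounded with `‖Dᵏψ(x)‖ ≤ C(1+‖x‖)^{-k}` (k ≤ 3), so E (`boundedPotentialIdentity_holds`, PROVED) gives the package identity for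
`φ = curl ψ`, every `ψ ∈ 𝒮`; each term of `T := S·G + κ⋆²M²(W ΔV − Z Δ²V) − wμ` is tempered (`V` smooth bounded, `G = ∂τ` with `τ ∈ L¹`,
`μ` finite) and for Schwartz `ψ` the functionals `A1, C1, J1` at `curl ψ` ARE the `𝒮′`-pairings `⟨−ΔV, curl ψ⟩, ⟨Δ²V, curl ψ⟩, ⟨G, curl ψ⟩`
(absolutely convergent integrations by parts: `ω, Dv, ∇ω ∈ L²` against Schwartz fields) — hence `⟨T, curl ψ⟩ = 0 ∀ ψ ∈ 𝒮`, i.e. `curl T = 0`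
in `𝒮′`; no further extension lemma is needed.  P2 (honest size + fallback): M on paper / XL in Lean (Fourier transform of a finite measure,
`𝒮′`-supports, «support {0} ⇒ polynomial» are thin in Mathlib; the Literature `𝓢'` API covers `Lp.toTemperedDistribution` and Fourier–Sobolev
weights).  LEAN-CHEAPER FALLBACK (same mathematics, fewer new objects): the PHYSICAL-SPACE KERNEL ROUTE — partial fractions
`1/(|k|²(W+Z|k|²)) = W⁻¹(|k|⁻² − (|k|² + m²)⁻¹)`, `m² = W/Z`, i.e. `κ⋆²M²W·V = ℙ[(Γ − Y_m) ∗ (S·G − wμ)]` with `Γ = 1/(4π‖x‖)` (Newton) and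
`Y_m = e^{−m‖x‖}/(4π‖x‖)` (Yukawa), once uniqueness in `L⁶` modulo gradients is known (the Liouville step, = «support {0}» in physical
clothes); then `∇(Γ − Y_m) ∈ L²(ℝ³)` (bounded near 0, `≍ ‖x‖⁻²` at ∞) ⇒ `∇(Γ − Y_m) ∗ τ ∈ L²` (Young, `τ ∈ L¹`); `Y_m ∗ (wμ) ∈ L²` (Young, `Y_m ∈ L²`,
`μ` finite); and the one genuinely new estimate `‖Γ ∗ (wμ)‖₂ ≤ ∫‖Γ(· − y) − Γ‖₂ ‖w(y)‖ dμ(y) = c·M∫‖y‖^{1/2}dμ` (zero mass `∫w dμ = 0`;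
`‖Γ(· − y) − Γ‖_{L²(ℝ³)} = c‖y‖^{1/2}` by scaling, finite since `|Γ(x−y) − Γ(x)|² ≲ ‖y‖²‖x‖⁻⁴` for `‖x‖ ≥ 2‖y‖` and `Γ² ∈ L¹_loc`).  P4 (record):
the lever is DIMENSION-DEPENDENT — the `Ĝ`-part of the budget is `‖τ‖₁²∫_{B₁}|k|⁻²dk < ∞` in 3-D and would diverge in 2-D (equivalently
`∇Γ ∈ L²` near infinity in 3-D only); and SIGN-DEPENDENT — `A1 ↔ +|k|²`, `C1 ↔ +|k|⁴` make the symbol `W|k|² + Z|k|⁴` zero-free off the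
origin (Yukawa, not Helmholtz: no resonant sphere). -/
theorem stub_fourierBudget : Sig.StubF := by
  sorry

/-! ## PROVED: the hypothesis of the axial dossier, hence K1b, from E, T, F -/

/-- **PROVED: no axial residue object** (the hypothesis `hres` of `ExtremiserLiouville.stub_noAnalyticExtremal_of_noAxialResidueObject`,
statement verbatim), from the stubs E, T, F and the tree's `L²` flux Liouville theorem `eq_farField_of_constSpeed_of_sq_integrable`. -/
theorem noAxialResidueObject_of (hE : Sig.StubE) (hT : Sig.StubT) (hF : Sig.StubF) :
    ∀ (w : E3 → E3) (c : E3) (M : ℝ) (μ : Measure E3),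
      AnalyticOnNhd ℝ w Set.univ → ContDiff ℝ (⊤ : ℕ∞) w → VectorCalculus.IsDivFree w →
      (∃ B : ℝ, ∀ x, ‖fderiv ℝ w x‖ ≤ B) → (∫⁻ x, ‖iteratedFDeriv ℝ 1 w x‖ₑ ^ 2 < ⊤) → (∫⁻ x, ‖iteratedFDeriv ℝ 2 w x‖ₑ ^ 2 < ⊤) →
      (∀ x, ‖w x‖ = M) → 0 < M → c 0 = 0 → c 1 = 0 → c 2 ≠ 0 → ‖c‖ = M →
      Tendsto (fun x => w x - c) (cocompact E3) (𝓝 0) → MemLp (fun x => w x - c) 6 volume →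
      0 < M * Real.sqrt (Zen w) * Real.sqrt (Wpa w) → kStar * M * Real.sqrt (Zen w) * Real.sqrt (Wpa w) = |Jst w| →
      -- the multiplier: finite, exact mass, the multiplier equation, zero barycentre
      IsFiniteMeasure μ → M ^ 2 * μ.real univ = Jst w ^ 2 →
      (∀ φ : E3 → E3, ContDiff ℝ ∞ φ → HasCompactSupport φ → VectorCalculus.IsDivFree φ →
        Jst w * J1 w φ - kStar ^ 2 * M ^ 2 * (Wpa w * A1 w φ + Zen w * C1 w φ) = ∫ x, ⟪w x, φ x⟫_ℝ ∂μ) →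
      (∫ x, w x ∂μ) = 0 →
      -- (S₀) the Stokeslet law without point force
      (∀ (c' : E3) (Ψ : E3 → E3), ContDiff ℝ ∞ Ψ → HasCompactSupport Ψ → VectorCalculus.IsDivFree Ψ →
        Tendsto (fun R : ℝ => kStar ^ 2 * M ^ 2 * Wpa w * (R⁻¹ * R⁻¹ * ∫ x, ⟪w x - c', (Δ Ψ) (R⁻¹ • x)⟫_ℝ)) atTop (𝓝 0)) →
      -- (V₀) the blow-down vorticity vanishes in `𝒟′`
      (∀ B : E3 → E3, ContDiff ℝ ∞ B → HasCompactSupport B →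
        Tendsto (fun R : ℝ => R⁻¹ * ∫ x, ⟪curl w x, B (R⁻¹ • x)⟫_ℝ) atTop (𝓝 0)) →
      -- (F/J) the axial flat-or-jet alternative is excluded
      ¬ ((∃ T : ℝ, 0 < T ∧ ¬ Integrable (fun x => {x : E3 | |x 2| ≤ T}.indicator (fun x => ‖w x - c‖ ^ 2) x) volume) ∨
         ((∀ T : ℝ, 0 < T → Integrable (fun x => {x : E3 | |x 2| ≤ T}.indicator (fun x => ‖w x - c‖ ^ 2) x) volume) ∧
           ∃ E₀ : ℝ, 0 < E₀ ∧ ∀ s : ℝ, (∫ x, deriv Real.smoothTransition (x 2 - s) * ‖w x - c‖ ^ 2) = E₀)) := by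
  intro w c M μ han hcd hdiv hB h1 h2 hM hMpos hc0 hc1 hc2 hcM hfar hL6 hpos heq hfin hmass hμ hb hS0 hV0 hFJ
  -- the package
  have hP : IsAxialResidue w c M μ :=
    ⟨han, hcd, hdiv, hB, h1, h2, hM, hMpos, hc0, hc1, hc2, hcM, hfar, hL6, hpos, heq, hfin, hmass, hμ, hb⟩
  -- E ⇒ T ⇒ F: the excess velocity is square integrable
  have hid : BoundedPotentialIdentity w M μ := hE w c M μ hP
  have htail : ∃ C : ℝ, ∀ s : ℝ, 1 ≤ s → s * μ.real {x : E3 | s < ‖x‖} ≤ C := hT w c M μ hP hid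
  have hL2 : Integrable (fun x => ‖w x - c‖ ^ 2) volume := hF w c M μ hP htail
  -- the `L²` flux Liouville theorem: `w ≡ c`
  have hc : c ≠ 0 := by rw [← norm_pos_iff, hcM]; exact hMpos
  have hw : ∀ x, w x = c :=
    ExtremiserLiouville.eq_farField_of_constSpeed_of_sq_integrable (hcd.of_le (by norm_cast)) hdiv hM hcM hc hL2
  -- neither FLAT nor JET survives `w ≡ c`
  rcases hFJ with ⟨T, hT0, hnot⟩ | ⟨hall, E₀, hE₀, hEc⟩
  · apply hnot
    have hzero : (fun x => {x : E3 | |x 2| ≤ T}.indicator (fun x => ‖w x - c‖ ^ 2) x) = fun _ => (0 : ℝ) := by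
      funext x
      by_cases hx : x ∈ {x : E3 | |x 2| ≤ T}
      · rw [Set.indicator_of_mem hx, hw x, sub_self, norm_zero]; norm_num
      · rw [Set.indicator_of_notMem hx]
    rw [hzero]
    exact integrable_zero _ _ _
  · have h0 := hEc 0
    have hzero : (fun x : E3 => deriv Real.smoothTransition (x 2 - 0) * ‖w x - c‖ ^ 2) = fun _ => (0 : ℝ) := by
      funext x
      rw [hw x, sub_self, norm_zero]; norm_num
    rw [hzero, integral_const, smul_eq_mul, mul_zero] at h0
    linarith

/-- **PROVED (modulo the stubs E, T, F): K1b — line B's `stub_noAnalyticExtremal`, statement verbatim**, via the K1b seat's axial dossier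
`ExtremiserLiouville.stub_noAnalyticExtremal_of_noAxialResidueObject` (…ConstantSpeedAxialDossier). -/
theorem noAnalyticExtremal :
    ¬ ∃ (w : EuclideanSpace ℝ (Fin 3) → EuclideanSpace ℝ (Fin 3)), AnalyticOnNhd ℝ w Set.univ ∧ (ContDiff ℝ (⊤ : ℕ∞) w ∧ Literature.Analysis.FluidPDE.VectorCalculus.IsDivFree w ∧ (∃ B : ℝ, ∀ x, ‖fderiv ℝ w x‖ ≤ B) ∧ (∫⁻ x, ‖iteratedFDeriv ℝ 1 w x‖ₑ ^ 2 < ⊤) ∧ (∫⁻ x, ‖iteratedFDeriv ℝ 2 w x‖ₑ ^ 2 < ⊤) ∧ ∃ M : ℝ, (∀ x, ‖w x‖ ≤ M) ∧ 0 < M * Real.sqrt (∫ x, ‖Literature.Analysis.FluidPDE.curl w x‖ ^ 2) * Real.sqrt (∫ x, Literature.Analysis.FluidPDE.frobeniusNormSq (fderiv ℝ (Literature.Analysis.FluidPDE.curl w) x)) ∧ (sInf {κ : ℝ | (∀ (v : EuclideanSpace ℝ (Fin 3) → EuclideanSpace ℝ (Fin 3)) (M B : ℝ), ContDiff ℝ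 (⊤ : ℕ∞) v → Literature.Analysis.FluidPDE.VectorCalculus.IsDivFree v → (∀ x, ‖v x‖ ≤ M) → (∀ x, ‖fderiv ℝ v x‖ ≤ B) → (∫⁻ x, ‖iteratedFDeriv ℝ 0 v x‖ₑ ^ 2 < ⊤) → (∫⁻ x, ‖iteratedFDeriv ℝ 1 v x‖ₑ ^ 2 < ⊤) → (∫⁻ x, ‖iteratedFDeriv ℝ 2 v x‖ₑ ^ 2 < ⊤) → |∫ x, ⟪Literature.Analysis.FluidPDE.curl v x, fderiv ℝ v x (Literature.Analysis.FluidPDE.curl v x)⟫_ℝ| ≤ κ * M * Real.sqrt (∫ x, ‖Literature.Analysis.FluidPDE.curl v x‖ ^ 2) * Real.sqrt (∫ x, Literature.Analysis.FluidPDE.frobeniusNormSq (fderiv ℝ (Literature.Analysis.FluidPDE.curl v) x)))}) * M * Real.sqrt (∫ x, ‖Literature.Analysis.FluidPDE.curl w x‖ ^ 2) * Real.sqrt (∫ x, Literature.Analysis.FluidPDE.frobeniusNormSq (fderiv ℝ (Literature.Analysis.FluidPDE.curl w) x)) ≤ |∫ x, ⟪Literature.Analysis.FluidPDE.curl w x,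 fderiv ℝ w x (Literature.Analysis.FluidPDE.curl w x)⟫_ℝ|) :=
  ExtremiserLiouville.stub_noAnalyticExtremal_of_noAxialResidueObject
    (noAxialResidueObject_of boundedPotentialIdentity_holds stub_tailLaw stub_fourierBudget)

/-! ## Line B's stubs K2, K1a (restated verbatim — shared), its rigidity lemma and its kernel-checked composition -/

/-- **K2 · stub_extremalPersistenceCompactness (crux of the line, XL; the load-bearing stub).**  PERSISTENCE COMPACTIFIES:
if near-extremal stretching persists in windowed log-time mean at levels β ↑ κ⋆² on windows of unbounded log-length along
Type-I singular flows (the scenario P of the module docstring), then an extremal ancient solution exists (module docstring).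
Mechanism (card §Stubs): choose β_n ↑ κ⋆², L_n ↑ ∞, flows u_n and windows; centre at an efficient time t_n near the argmax of
the Leray number m(t) = ‖u(t)‖∞√(T−t)/√ν over the window (so the KNSS-rescaled flow is bounded by 2 backward, whatever the
Type-I constant C_n), at a point of the heavy near-extremal piece; SCALE LOCK: in a near-extremal window with the enstrophy
keeping Leray's pace, the dissipation length ℓ = √(Z/P) is comparable to the parabolic length √(ν(T−t)) on a set of times of
positive log-density (d log Z/ds ≤ 2κ⋆m/ℓ̃ − 2/ℓ̃², ℓ̃ = ℓ/√(ν(T−t)), forces ℓ̃ ∈ [2κ⋆m ∓ 2√(κ⋆²m²−1)] where Z grows), so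
the rescaled viscosity stays 1 and the efficient structure lives at the parabolic scale; KNSS C^∞_loc compactness of bounded
Oseen-mild sequences (tree `isKNSSBlowupLimit_of_oseenMild_zoom`, `KNSS2009_lemma61_*`) gives the limit W in the Oseen
gauge; TIGHTNESS of near-maximisers of R (splitting far-apart pieces is R-neutral only at equal amplitude and equal Z/P
ratio — Cauchy–Schwarz — so every heavy piece of a near-extremal field is near-extremal) and Fatou on the followed piece give
extremal slices for a.e. time of an interval around the centring time.
Why it might fail: loss of tightness (the efficient structure at time t and at time t' are different structures escaping to
infinity from each other in rescaled units — then only one instant survives); or the followed piece loses finite (Z,P) in the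
limit (enstrophy spread over ≫ parabolic scales); or near-extremal windows realise their mean by SHORT bursts at scales
≪ parabolic (ℓ̃ → 0 on the efficient set, Euler scaling) — the scale-lock inequality bounds this only where Z grows. -/
theorem stub_extremalPersistenceCompactness :
    (∀ β : ℝ, β < (sInf {κ : ℝ | (∀ (v : EuclideanSpace ℝ (Fin 3) → EuclideanSpace ℝ (Fin 3)) (M B : ℝ), ContDiff ℝ (⊤ : ℕ∞) v → Literature.Analysis.FluidPDE.VectorCalculus.IsDivFree v → (∀ x, ‖v x‖ ≤ M) → (∀ x, ‖fderiv ℝ v x‖ ≤ B) → (∫⁻ x, ‖iteratedFDeriv ℝ 0 v x‖ₑ ^ 2 < ⊤) → (∫⁻ x, ‖iteratedFDeriv ℝ 1 v x‖ₑ ^ 2 < ⊤) → (∫⁻ x, ‖iteratedFDeriv ℝ 2 v x‖ₑ ^ 2 < ⊤) → |∫ x, ⟪Literature.Analysis.FluidPDE.curl v x, fderiv ℝ v x (Literature.Analysis.FluidPDE.curl v x)⟫_ℝ| ≤ κ * M * Real.sqrt (∫ x, ‖Literature.Analysis.FluidPDE.curl v x‖ ^ 2) * Real.sqrt (∫ x,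 Literature.Analysis.FluidPDE.frobeniusNormSq (fderiv ℝ (Literature.Analysis.FluidPDE.curl v) x)))}) ^ 2 → ∀ L : ℝ, 0 < L → ∃ (C ν T : ℝ) (u : ℝ → EuclideanSpace ℝ (Fin 3) → EuclideanSpace ℝ (Fin 3)) (p : ℝ → EuclideanSpace ℝ (Fin 3) → ℝ), 0 < C ∧ 0 < ν ∧ 0 < T ∧ Literature.Analysis.FluidPDE.IsClassicalNSSolutionOn (Set.Ico 0 T) ν 0 u p ∧ Literature.Analysis.FluidPDE.IsLerayHopfOn T ν 0 (u 0) u ∧ Literature.Analysis.FluidPDE.HasRapidSpatialDecay (u 0) ∧ (∀ᶠ t in 𝓝[<] T, ∀ x, Real.sqrt (T - t) * ‖u t x‖ ≤ C * Real.sqrt ν) ∧ ¬ Literature.Analysis.FluidPDE.HasSmoothExtensionPast ν 0 u T ∧ ∀ (k : ℝ → ℝ), Measurable k → (∀ τ, 0 ≤ k τ ∧ k τ ≤ 1) → (∀ t ∈ Set.Ico 0 T, ∀ M : ℝ, (∀ x, ‖u t x‖ ≤ M) → |∫ x, ⟪Literature.Analysis.FluidPDE.curl (u t) x, fderiv ℝ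 (u t) x (Literature.Analysis.FluidPDE.curl (u t) x)⟫_ℝ| ≤ k t * M * Real.sqrt (∫ x, ‖Literature.Analysis.FluidPDE.curl (u t) x‖ ^ 2) * Real.sqrt (∫ x, Literature.Analysis.FluidPDE.frobeniusNormSq (fderiv ℝ (Literature.Analysis.FluidPDE.curl (u t)) x))) → ∀ t₁ ∈ Set.Ico 0 T, ∃ s₁ s₂ : ℝ, t₁ ≤ s₁ ∧ s₁ < s₂ ∧ s₂ < T ∧ L ≤ Real.log ((T - s₁) / (T - s₂)) ∧ β * Real.log ((T - s₁) / (T - s₂)) < ∫ τ in s₁..s₂, k τ ^ 2 / (T - τ)) → ∃ (W : ℝ → EuclideanSpace ℝ (Fin 3) → EuclideanSpace ℝ (Fin 3)) (a b : ℝ), (Literature.Analysis.FluidPDE.IsKNSSBlowupLimit W ∧ (∀ s t : ℝ, s < t → t < 0 → ∀ x, W t x = Literature.Analysis.FluidPDE.heatFlow (W s) (t - s) x - Literature.Analysis.FluidPDE.oseenDuhamel 1 s W W t x)) ∧ a < b ∧ b ≤ 0 ∧ ∀ᵐ t : ℝ, t ∈ Set.Ioo a b → (ContDiff ℝ (⊤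 : ℕ∞) (W t) ∧ Literature.Analysis.FluidPDE.VectorCalculus.IsDivFree (W t) ∧ (∃ B : ℝ, ∀ x, ‖fderiv ℝ (W t) x‖ ≤ B) ∧ (∫⁻ x, ‖iteratedFDeriv ℝ 1 (W t) x‖ₑ ^ 2 < ⊤) ∧ (∫⁻ x, ‖iteratedFDeriv ℝ 2 (W t) x‖ₑ ^ 2 < ⊤) ∧ ∃ M : ℝ, (∀ x, ‖(W t) x‖ ≤ M) ∧ 0 < M * Real.sqrt (∫ x, ‖Literature.Analysis.FluidPDE.curl (W t) x‖ ^ 2) * Real.sqrt (∫ x, Literature.Analysis.FluidPDE.frobeniusNormSq (fderiv ℝ (Literature.Analysis.FluidPDE.curl (W t)) x)) ∧ (sInf {κ : ℝ | (∀ (v : EuclideanSpace ℝ (Fin 3) → EuclideanSpace ℝ (Fin 3)) (M B : ℝ), ContDiff ℝ (⊤ : ℕ∞) v → Literature.Analysis.FluidPDE.VectorCalculus.IsDivFree v → (∀ x, ‖v x‖ ≤ M) → (∀ x, ‖fderiv ℝ v x‖ ≤ B) → (∫⁻ x, ‖iteratedFDeriv ℝ 0 v x‖ₑ ^ 2 <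 ⊤) → (∫⁻ x, ‖iteratedFDeriv ℝ 1 v x‖ₑ ^ 2 < ⊤) → (∫⁻ x, ‖iteratedFDeriv ℝ 2 v x‖ₑ ^ 2 < ⊤) → |∫ x, ⟪Literature.Analysis.FluidPDE.curl v x, fderiv ℝ v x (Literature.Analysis.FluidPDE.curl v x)⟫_ℝ| ≤ κ * M * Real.sqrt (∫ x, ‖Literature.Analysis.FluidPDE.curl v x‖ ^ 2) * Real.sqrt (∫ x, Literature.Analysis.FluidPDE.frobeniusNormSq (fderiv ℝ (Literature.Analysis.FluidPDE.curl v) x)))}) * M * Real.sqrt (∫ x, ‖Literature.Analysis.FluidPDE.curl (W t) x‖ ^ 2) * Real.sqrt (∫ x, Literature.Analysis.FluidPDE.frobeniusNormSq (fderiv ℝ (Literature.Analysis.FluidPDE.curl (W t)) x)) ≤ |∫ x, ⟪Literature.Analysis.FluidPDE.curl (W t) x, fderiv ℝ (W t) x (Literature.Analysis.FluidPDE.curl (W t) x)⟫_ℝ|) := by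
  sorry

section K1aProof
open Literature.Analysis Literature.Analysis.FluidPDE Literature.Analysis.FluidPDE.LocalTypeIBlowup TopologicalSpace

/-- **K1a · analyticSlices — PROVED (rev 1.4, ns-idea-10 g8; was the shared stub `stub_analyticSlices`).**  Slices of a KNSS blow-up
limit in the Oseen gauge are real-analytic: Lemarié-Rieusset 2016 Thm 9.12 in the tree's proved local form
`lemarieRieusset2016_local_analyticity_holds` from the bounded datum `W s₁` (`M = 2`), identified with `W` on the window by
`oseenMild_bounded_unique`, then `analyticOnNhd_slice` (port of `IsTypeIAncientMild.analyticOnNhd_slice_univ` to `|W| ≤ 1`). -/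
theorem analyticSlices :
    ∀ (W : ℝ → EuclideanSpace ℝ (Fin 3) → EuclideanSpace ℝ (Fin 3)), (Literature.Analysis.FluidPDE.IsKNSSBlowupLimit W ∧ (∀ s t : ℝ, s < t → t < 0 → ∀ x, W t x = Literature.Analysis.FluidPDE.heatFlow (W s) (t - s) x - Literature.Analysis.FluidPDE.oseenDuhamel 1 s W W t x)) → ∀ t : ℝ, t < 0 → AnalyticOnNhd ℝ (W t) Set.univ := by
  intro W hWp t ht
  obtain ⟨hW, hrep⟩ := hWp
  obtain ⟨ε, hε, C₀, hC₀, hloc⟩ := lemarieRieusset2016_local_analyticity_holds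
  have hsm : ContDiffOn ℝ (⊤ : ℕ∞) (uncurry W) (Iio 0 ×ˢ univ) := hW.smooth
  have hslice : ∀ τ : ℝ, τ < 0 → ContDiff ℝ (⊤ : ℕ∞) (W τ) := fun τ hτ =>
    hsm.comp_contDiff (contDiff_prodMk_right τ) fun x => mk_mem_prod (mem_Iio.2 hτ) (mem_univ x)
  have hcont : ∀ τ : ℝ, τ < 0 → Continuous (W τ) := fun τ hτ => (hslice τ hτ).continuous
  -- uniform bound `1` and the window data
  set Mb : ℝ := (1 : ℝ) + 1 with hMb
  have hMb0 : 0 < Mb := by rw [hMb]; norm_num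
  have hlen : 0 < ε * 1 / Mb ^ 2 := by positivity
  set s₁ : ℝ := t - (ε * 1 / Mb ^ 2) / 2 with hs₁
  have hs₁t : s₁ < t := by rw [hs₁]; linarith
  have hs₁0 : s₁ < 0 := by linarith
  have ha_meas : AEStronglyMeasurable (W s₁) volume := (hcont s₁ hs₁0).aestronglyMeasurable
  have ha_bd : eLpNorm (W s₁) ∞ volume ≤ ENNReal.ofReal Mb := by
    rw [eLpNorm_exponent_top]
    refine eLpNormEssSup_le_of_ae_bound (Eventually.of_forall fun x => ?_)
    exact (hW.norm_le_one s₁ hs₁0 x).trans (by rw [hMb]; norm_num)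
  obtain ⟨vl, hvl_an, hvl_eq, hvl_bd⟩ := hloc one_pos s₁ hMb0 ha_meas ha_bd
  -- the common window `(s₁, T₂)`, `T₂ = min (s₁ + ε/Mb²) (t/2) ∋ t`
  set T₂ : ℝ := min (s₁ + ε * 1 / Mb ^ 2) (t / 2) with hT₂
  have htT₂ : t < T₂ := lt_min (by rw [hs₁]; linarith) (by linarith)
  have hT₂0 : T₂ < 0 := (min_le_right _ _).trans_lt (by linarith)
  have hT₂h : T₂ ≤ s₁ + ε * 1 / Mb ^ 2 := min_le_left _ _
  -- uniqueness of bounded Oseen-mild solutions on the window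
  set M' : ℝ := max 1 (C₀ * Mb) with hM'
  have hM'0 : 0 ≤ M' := zero_le_one.trans (le_max_left _ _)
  have hum : AEStronglyMeasurable (uncurry W) (volume.restrict (Ioo s₁ T₂ ×ˢ univ)) :=
    (hsm.continuousOn.mono (prod_mono (fun τ hτ => mem_Iio.2 ((mem_Ioo.1 hτ).2.trans hT₂0))
      Subset.rfl)).aestronglyMeasurable (measurableSet_Ioo.prod MeasurableSet.univ)
  have hvm : AEStronglyMeasurable (uncurry vl) (volume.restrict (Ioo s₁ T₂ ×ˢ univ)) :=
    (hvl_an.continuousOn.mono (prod_mono (Ioo_subset_Ioo_right hT₂h) Subset.rfl)).aestronglyMeasurable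
      (measurableSet_Ioo.prod MeasurableSet.univ)
  have huM : ∀ τ ∈ Ioo s₁ T₂, ∀ y, ‖W τ y‖ ≤ M' := fun τ hτ y =>
    (hW.norm_le_one τ (hτ.2.trans hT₂0) y).trans (le_max_left _ _)
  have hvM : ∀ τ ∈ Ioo s₁ T₂, ∀ y, ‖vl τ y‖ ≤ M' := fun τ hτ y =>
    (hvl_bd τ ⟨hτ.1, hτ.2.trans_le hT₂h⟩ y).trans (le_max_right _ _)
  have hu : ∀ τ ∈ Ioo s₁ T₂, W τ =ᵐ[volume] fun x =>
      UnboundedOperators.heatExtension (W s₁) (1 * (τ - s₁)) x - oseenDuhamel 1 s₁ W W τ x :=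
    fun τ hτ => Eventually.of_forall fun x => by
      rw [one_mul, hrep s₁ τ hτ.1 (hτ.2.trans hT₂0) x, heatFlow_of_pos _ (sub_pos.2 hτ.1)]
  have hv : ∀ τ ∈ Ioo s₁ T₂, vl τ =ᵐ[volume] fun x =>
      UnboundedOperators.heatExtension (W s₁) (1 * (τ - s₁)) x - oseenDuhamel 1 s₁ vl vl τ x :=
    fun τ hτ => Eventually.of_forall fun x => hvl_eq τ ⟨hτ.1, hτ.2.trans_le hT₂h⟩ x
  have heq := oseenMild_bounded_unique
    (U := fun τ x => UnboundedOperators.heatExtension (W s₁) (1 * (τ - s₁)) x)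
    one_pos hM'0 hum hvm huM hvM hu hv t ⟨hs₁t, htT₂⟩
  have htwin : t ∈ Ioo s₁ (s₁ + ε * 1 / Mb ^ 2) := ⟨hs₁t, htT₂.trans_le hT₂h⟩
  have hvlt : AnalyticOnNhd ℝ (vl t) univ := analyticOnNhd_slice hvl_an htwin
  have hUt : W t = vl t :=
    (Continuous.ae_eq_iff_eq volume (hcont t ht) (continuousOn_univ.1 hvlt.continuousOn)).1 heq
  rw [hUt]
  exact hvlt

end K1aProof


/-- **Rigidity, dynamic form (PROVED from K1a, K1b): no extremal ancient solution exists.**  From a.e.-extremality on a time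
interval of positive length pick one extremal time t < 0 (`ae_iff`, `Real.volume_Ioo`), read off the extremal slice, and hand
the analytic (K1a) extremal field W(t) to K1b. -/
theorem extremalAncient_false_of
    (h1a : ∀ (W : ℝ → EuclideanSpace ℝ (Fin 3) → EuclideanSpace ℝ (Fin 3)), (Literature.Analysis.FluidPDE.IsKNSSBlowupLimit W ∧ (∀ s t : ℝ, s < t → t < 0 → ∀ x, W t x = Literature.Analysis.FluidPDE.heatFlow (W s) (t - s) x - Literature.Analysis.FluidPDE.oseenDuhamel 1 s W W t x)) → ∀ t : ℝ, t < 0 → AnalyticOnNhd ℝ (W t) Set.univ)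
    (h1b : ¬ ∃ (w : EuclideanSpace ℝ (Fin 3) → EuclideanSpace ℝ (Fin 3)), AnalyticOnNhd ℝ w Set.univ ∧ (ContDiff ℝ (⊤ : ℕ∞) w ∧ Literature.Analysis.FluidPDE.VectorCalculus.IsDivFree w ∧ (∃ B : ℝ, ∀ x, ‖fderiv ℝ w x‖ ≤ B) ∧ (∫⁻ x, ‖iteratedFDeriv ℝ 1 w x‖ₑ ^ 2 < ⊤) ∧ (∫⁻ x, ‖iteratedFDeriv ℝ 2 w x‖ₑ ^ 2 < ⊤) ∧ ∃ M : ℝ, (∀ x, ‖w x‖ ≤ M) ∧ 0 < M * Real.sqrt (∫ x, ‖Literature.Analysis.FluidPDE.curl w x‖ ^ 2) * Real.sqrt (∫ x, Literature.Analysis.FluidPDE.frobeniusNormSq (fderiv ℝ (Literature.Analysis.FluidPDE.curl w) x)) ∧ (sInf {κ : ℝ | (∀ (v : EuclideanSpace ℝ (Fin 3) → EuclideanSpace ℝ (Fin 3)) (M B : ℝ), ContDiff ℝ (⊤ : ℕ∞) v → Literature.Analysis.FluidPDE.VectorCalculus.IsDivFree v → (∀ x, ‖v x‖ ≤ M) →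 (∀ x, ‖fderiv ℝ v x‖ ≤ B) → (∫⁻ x, ‖iteratedFDeriv ℝ 0 v x‖ₑ ^ 2 < ⊤) → (∫⁻ x, ‖iteratedFDeriv ℝ 1 v x‖ₑ ^ 2 < ⊤) → (∫⁻ x, ‖iteratedFDeriv ℝ 2 v x‖ₑ ^ 2 < ⊤) → |∫ x, ⟪Literature.Analysis.FluidPDE.curl v x, fderiv ℝ v x (Literature.Analysis.FluidPDE.curl v x)⟫_ℝ| ≤ κ * M * Real.sqrt (∫ x, ‖Literature.Analysis.FluidPDE.curl v x‖ ^ 2) * Real.sqrt (∫ x, Literature.Analysis.FluidPDE.frobeniusNormSq (fderiv ℝ (Literature.Analysis.FluidPDE.curl v) x)))}) * M * Real.sqrt (∫ x, ‖Literature.Analysis.FluidPDE.curl w x‖ ^ 2) * Real.sqrt (∫ x, Literature.Analysis.FluidPDE.frobeniusNormSq (fderiv ℝ (Literature.Analysis.FluidPDE.curl w) x)) ≤ |∫ x, ⟪Literature.Analysis.FluidPDE.curl w x, fderiv ℝ w x (Literature.Analysis.FluidPDE.curl w x)⟫_ℝ|)) :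
    ¬ (∃ (W : ℝ → EuclideanSpace ℝ (Fin 3) → EuclideanSpace ℝ (Fin 3)) (a b : ℝ), (Literature.Analysis.FluidPDE.IsKNSSBlowupLimit W ∧ (∀ s t : ℝ, s < t → t < 0 → ∀ x, W t x = Literature.Analysis.FluidPDE.heatFlow (W s) (t - s) x - Literature.Analysis.FluidPDE.oseenDuhamel 1 s W W t x)) ∧ a < b ∧ b ≤ 0 ∧ ∀ᵐ t : ℝ, t ∈ Set.Ioo a b → (ContDiff ℝ (⊤ : ℕ∞) (W t) ∧ Literature.Analysis.FluidPDE.VectorCalculus.IsDivFree (W t) ∧ (∃ B : ℝ, ∀ x, ‖fderiv ℝ (W t) x‖ ≤ B) ∧ (∫⁻ x, ‖iteratedFDeriv ℝ 1 (W t) x‖ₑ ^ 2 < ⊤) ∧ (∫⁻ x, ‖iteratedFDeriv ℝ 2 (W t) x‖ₑ ^ 2 < ⊤) ∧ ∃ M : ℝ, (∀ x, ‖(W t) x‖ ≤ M) ∧ 0 < M * Real.sqrt (∫ x, ‖Literature.Analysis.FluidPDE.curl (W t) x‖ ^ 2) * Real.sqrt (∫ x, Literature.Analysis.FluidPDE.frobeniusNormSq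 (fderiv ℝ (Literature.Analysis.FluidPDE.curl (W t)) x)) ∧ (sInf {κ : ℝ | (∀ (v : EuclideanSpace ℝ (Fin 3) → EuclideanSpace ℝ (Fin 3)) (M B : ℝ), ContDiff ℝ (⊤ : ℕ∞) v → Literature.Analysis.FluidPDE.VectorCalculus.IsDivFree v → (∀ x, ‖v x‖ ≤ M) → (∀ x, ‖fderiv ℝ v x‖ ≤ B) → (∫⁻ x, ‖iteratedFDeriv ℝ 0 v x‖ₑ ^ 2 < ⊤) → (∫⁻ x, ‖iteratedFDeriv ℝ 1 v x‖ₑ ^ 2 < ⊤) → (∫⁻ x, ‖iteratedFDeriv ℝ 2 v x‖ₑ ^ 2 < ⊤) → |∫ x, ⟪Literature.Analysis.FluidPDE.curl v x, fderiv ℝ v x (Literature.Analysis.FluidPDE.curl v x)⟫_ℝ| ≤ κ * M * Real.sqrt (∫ x, ‖Literature.Analysis.FluidPDE.curl v x‖ ^ 2) * Real.sqrt (∫ x, Literature.Analysis.FluidPDE.frobeniusNormSq (fderiv ℝ (Literature.Analysis.FluidPDE.curl v) x)))}) * M * Real.sqrt (∫ x, ‖Literature.Analysis.FluidPDE.curl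 (W t) x‖ ^ 2) * Real.sqrt (∫ x, Literature.Analysis.FluidPDE.frobeniusNormSq (fderiv ℝ (Literature.Analysis.FluidPDE.curl (W t)) x)) ≤ |∫ x, ⟪Literature.Analysis.FluidPDE.curl (W t) x, fderiv ℝ (W t) x (Literature.Analysis.FluidPDE.curl (W t) x)⟫_ℝ|)) := by
  rintro ⟨W, a, b, hW, hab, hb0, hae⟩
  have hex : ∃ t ∈ Set.Ioo a b, (ContDiff ℝ (⊤ : ℕ∞) (W t) ∧ Literature.Analysis.FluidPDE.VectorCalculus.IsDivFree (W t) ∧ (∃ B : ℝ, ∀ x, ‖fderiv ℝ (W t) x‖ ≤ B) ∧ (∫⁻ x, ‖iteratedFDeriv ℝ 1 (W t) x‖ₑ ^ 2 < ⊤) ∧ (∫⁻ x, ‖iteratedFDeriv ℝ 2 (W t) x‖ₑ ^ 2 < ⊤) ∧ ∃ M : ℝ, (∀ x, ‖(W t) x‖ ≤ M) ∧ 0 < M * Real.sqrt (∫ x, ‖Literature.Analysis.FluidPDE.curl (W t) x‖ ^ 2) * Real.sqrt (∫ x, Literature.Analysis.FluidPDE.frobeniusNormSq (fderiv ℝ (Literature.Analysis.FluidPDE.curl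 (W t)) x)) ∧ (sInf {κ : ℝ | (∀ (v : EuclideanSpace ℝ (Fin 3) → EuclideanSpace ℝ (Fin 3)) (M B : ℝ), ContDiff ℝ (⊤ : ℕ∞) v → Literature.Analysis.FluidPDE.VectorCalculus.IsDivFree v → (∀ x, ‖v x‖ ≤ M) → (∀ x, ‖fderiv ℝ v x‖ ≤ B) → (∫⁻ x, ‖iteratedFDeriv ℝ 0 v x‖ₑ ^ 2 < ⊤) → (∫⁻ x, ‖iteratedFDeriv ℝ 1 v x‖ₑ ^ 2 < ⊤) → (∫⁻ x, ‖iteratedFDeriv ℝ 2 v x‖ₑ ^ 2 < ⊤) → |∫ x, ⟪Literature.Analysis.FluidPDE.curl v x, fderiv ℝ v x (Literature.Analysis.FluidPDE.curl v x)⟫_ℝ| ≤ κ * M * Real.sqrt (∫ x, ‖Literature.Analysis.FluidPDE.curl v x‖ ^ 2) * Real.sqrt (∫ x, Literature.Analysis.FluidPDE.frobeniusNormSq (fderiv ℝ (Literature.Analysis.FluidPDE.curl v) x)))}) * M * Real.sqrt (∫ x, ‖Literature.Analysis.FluidPDE.curl (W t) x‖ ^ 2) * Real.sqrt (∫ x,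 Literature.Analysis.FluidPDE.frobeniusNormSq (fderiv ℝ (Literature.Analysis.FluidPDE.curl (W t)) x)) ≤ |∫ x, ⟪Literature.Analysis.FluidPDE.curl (W t) x, fderiv ℝ (W t) x (Literature.Analysis.FluidPDE.curl (W t) x)⟫_ℝ|) := by
    by_contra hno
    have hsub : Set.Ioo a b ⊆ {t : ℝ | ¬ (t ∈ Set.Ioo a b → (ContDiff ℝ (⊤ : ℕ∞) (W t) ∧ Literature.Analysis.FluidPDE.VectorCalculus.IsDivFree (W t) ∧ (∃ B : ℝ, ∀ x, ‖fderiv ℝ (W t) x‖ ≤ B) ∧ (∫⁻ x, ‖iteratedFDeriv ℝ 1 (W t) x‖ₑ ^ 2 < ⊤) ∧ (∫⁻ x, ‖iteratedFDeriv ℝ 2 (W t) x‖ₑ ^ 2 < ⊤) ∧ ∃ M : ℝ, (∀ x, ‖(W t) x‖ ≤ M) ∧ 0 < M * Real.sqrt (∫ x, ‖Literature.Analysis.FluidPDE.curl (W t) x‖ ^ 2) * Real.sqrt (∫ x, Literature.Analysis.FluidPDE.frobeniusNormSq (fderiv ℝ (Literature.Analysis.FluidPDE.curl (W t)) x)) ∧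 (sInf {κ : ℝ | (∀ (v : EuclideanSpace ℝ (Fin 3) → EuclideanSpace ℝ (Fin 3)) (M B : ℝ), ContDiff ℝ (⊤ : ℕ∞) v → Literature.Analysis.FluidPDE.VectorCalculus.IsDivFree v → (∀ x, ‖v x‖ ≤ M) → (∀ x, ‖fderiv ℝ v x‖ ≤ B) → (∫⁻ x, ‖iteratedFDeriv ℝ 0 v x‖ₑ ^ 2 < ⊤) → (∫⁻ x, ‖iteratedFDeriv ℝ 1 v x‖ₑ ^ 2 < ⊤) → (∫⁻ x, ‖iteratedFDeriv ℝ 2 v x‖ₑ ^ 2 < ⊤) → |∫ x, ⟪Literature.Analysis.FluidPDE.curl v x, fderiv ℝ v x (Literature.Analysis.FluidPDE.curl v x)⟫_ℝ| ≤ κ * M * Real.sqrt (∫ x, ‖Literature.Analysis.FluidPDE.curl v x‖ ^ 2) * Real.sqrt (∫ x, Literature.Analysis.FluidPDE.frobeniusNormSq (fderiv ℝ (Literature.Analysis.FluidPDE.curl v) x)))}) * M * Real.sqrt (∫ x, ‖Literature.Analysis.FluidPDE.curl (W t) x‖ ^ 2) * Real.sqrt (∫ x, Literature.Analysis.FluidPDE.frobeniusNormSq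 (fderiv ℝ (Literature.Analysis.FluidPDE.curl (W t)) x)) ≤ |∫ x, ⟪Literature.Analysis.FluidPDE.curl (W t) x, fderiv ℝ (W t) x (Literature.Analysis.FluidPDE.curl (W t) x)⟫_ℝ|))} :=
      fun t ht himp => hno ⟨t, ht, himp ht⟩
    have h0 : volume (Set.Ioo a b) = 0 := measure_mono_null hsub (ae_iff.mp hae)
    rw [Real.volume_Ioo, ENNReal.ofReal_eq_zero] at h0
    linarith
  obtain ⟨t, ht, hcd, hdiv, hB, h1, h2, M, hM, hpos, hext⟩ := hex
  exact h1b ⟨W t, h1a W hW t (lt_of_lt_of_le ht.2 hb0), hcd, hdiv, hB, h1, h2, M, hM, hpos, hext⟩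

/-- **Composition (kernel-checked).**  K2 and K1 give ¬P; the rest is the block-to-log bookkeeping described in the module
docstring (`blocksToLog_general`, `intervalIntegrable_coeff_sq_div`, `sharpDepletion_gt`, `sharpDepletion_le`), with
θ := √(max β 0)/κ⋆ and B := max β 0 · L. -/
theorem NearExtremalTransience_of :
    Summit.NavierStokesRegularity.NavierStokesRegularity.Theses.ExtremiserTransience.NearExtremalTransience := by
  -- COMPACTNESS (stub K2) and RIGIDITY (proved above from the stubs K1a, K1b): the registered stubs enter BY NAME.
  have hK2 : (∀ β : ℝ, β < (sInf {κ : ℝ | (∀ (v : EuclideanSpace ℝ (Fin 3) → EuclideanSpace ℝ (Fin 3)) (M B : ℝ), ContDiff ℝ (⊤ : ℕ∞) v → Literature.Analysis.FluidPDE.VectorCalculus.IsDivFree v → (∀ x, ‖v x‖ ≤ M) → (∀ x, ‖fderiv ℝ v x‖ ≤ B) → (∫⁻ x, ‖iteratedFDeriv ℝ 0 v x‖ₑ ^ 2 < ⊤) → (∫⁻ x, ‖iteratedFDeriv ℝ 1 v x‖ₑ ^ 2 < ⊤) → (∫⁻ x, ‖iteratedFDeriv ℝ 2 v x‖ₑ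 ^ 2 < ⊤) → |∫ x, ⟪Literature.Analysis.FluidPDE.curl v x, fderiv ℝ v x (Literature.Analysis.FluidPDE.curl v x)⟫_ℝ| ≤ κ * M * Real.sqrt (∫ x, ‖Literature.Analysis.FluidPDE.curl v x‖ ^ 2) * Real.sqrt (∫ x, Literature.Analysis.FluidPDE.frobeniusNormSq (fderiv ℝ (Literature.Analysis.FluidPDE.curl v) x)))}) ^ 2 → ∀ L : ℝ, 0 < L → ∃ (C ν T : ℝ) (u : ℝ → EuclideanSpace ℝ (Fin 3) → EuclideanSpace ℝ (Fin 3)) (p : ℝ → EuclideanSpace ℝ (Fin 3) → ℝ), 0 < C ∧ 0 < ν ∧ 0 < T ∧ Literature.Analysis.FluidPDE.IsClassicalNSSolutionOn (Set.Ico 0 T) ν 0 u p ∧ Literature.Analysis.FluidPDE.IsLerayHopfOn T ν 0 (u 0) u ∧ Literature.Analysis.FluidPDE.HasRapidSpatialDecay (u 0) ∧ (∀ᶠ t in 𝓝[<] T, ∀ x, Real.sqrt (T - t) * ‖u t x‖ ≤ C * Real.sqrt ν) ∧ ¬ Literature.Analysis.FluidPDE.HasSmoothExtensionPast ν 0 u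 T ∧ ∀ (k : ℝ → ℝ), Measurable k → (∀ τ, 0 ≤ k τ ∧ k τ ≤ 1) → (∀ t ∈ Set.Ico 0 T, ∀ M : ℝ, (∀ x, ‖u t x‖ ≤ M) → |∫ x, ⟪Literature.Analysis.FluidPDE.curl (u t) x, fderiv ℝ (u t) x (Literature.Analysis.FluidPDE.curl (u t) x)⟫_ℝ| ≤ k t * M * Real.sqrt (∫ x, ‖Literature.Analysis.FluidPDE.curl (u t) x‖ ^ 2) * Real.sqrt (∫ x, Literature.Analysis.FluidPDE.frobeniusNormSq (fderiv ℝ (Literature.Analysis.FluidPDE.curl (u t)) x))) → ∀ t₁ ∈ Set.Ico 0 T, ∃ s₁ s₂ : ℝ, t₁ ≤ s₁ ∧ s₁ < s₂ ∧ s₂ < T ∧ L ≤ Real.log ((T - s₁) / (T - s₂)) ∧ β * Real.log ((T - s₁) / (T - s₂)) < ∫ τ in s₁..s₂, k τ ^ 2 / (T - τ)) → ∃ (W : ℝ → EuclideanSpace ℝ (Fin 3) → EuclideanSpace ℝ (Fin 3)) (a b : ℝ), (Literature.Analysis.FluidPDE.IsKNSSBlowupLimit W ∧ (∀ s t : ℝ,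 s < t → t < 0 → ∀ x, W t x = Literature.Analysis.FluidPDE.heatFlow (W s) (t - s) x - Literature.Analysis.FluidPDE.oseenDuhamel 1 s W W t x)) ∧ a < b ∧ b ≤ 0 ∧ ∀ᵐ t : ℝ, t ∈ Set.Ioo a b → (ContDiff ℝ (⊤ : ℕ∞) (W t) ∧ Literature.Analysis.FluidPDE.VectorCalculus.IsDivFree (W t) ∧ (∃ B : ℝ, ∀ x, ‖fderiv ℝ (W t) x‖ ≤ B) ∧ (∫⁻ x, ‖iteratedFDeriv ℝ 1 (W t) x‖ₑ ^ 2 < ⊤) ∧ (∫⁻ x, ‖iteratedFDeriv ℝ 2 (W t) x‖ₑ ^ 2 < ⊤) ∧ ∃ M : ℝ, (∀ x, ‖(W t) x‖ ≤ M) ∧ 0 < M * Real.sqrt (∫ x, ‖Literature.Analysis.FluidPDE.curl (W t) x‖ ^ 2) * Real.sqrt (∫ x, Literature.Analysis.FluidPDE.frobeniusNormSq (fderiv ℝ (Literature.Analysis.FluidPDE.curl (W t)) x)) ∧ (sInf {κ : ℝ | (∀ (v : EuclideanSpace ℝ (Fin 3) → EuclideanSpace ℝ (Fin 3)) (M B :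 ℝ), ContDiff ℝ (⊤ : ℕ∞) v → Literature.Analysis.FluidPDE.VectorCalculus.IsDivFree v → (∀ x, ‖v x‖ ≤ M) → (∀ x, ‖fderiv ℝ v x‖ ≤ B) → (∫⁻ x, ‖iteratedFDeriv ℝ 0 v x‖ₑ ^ 2 < ⊤) → (∫⁻ x, ‖iteratedFDeriv ℝ 1 v x‖ₑ ^ 2 < ⊤) → (∫⁻ x, ‖iteratedFDeriv ℝ 2 v x‖ₑ ^ 2 < ⊤) → |∫ x, ⟪Literature.Analysis.FluidPDE.curl v x, fderiv ℝ v x (Literature.Analysis.FluidPDE.curl v x)⟫_ℝ| ≤ κ * M * Real.sqrt (∫ x, ‖Literature.Analysis.FluidPDE.curl v x‖ ^ 2) * Real.sqrt (∫ x, Literature.Analysis.FluidPDE.frobeniusNormSq (fderiv ℝ (Literature.Analysis.FluidPDE.curl v) x)))}) * M * Real.sqrt (∫ x, ‖Literature.Analysis.FluidPDE.curl (W t) x‖ ^ 2) * Real.sqrt (∫ x, Literature.Analysis.FluidPDE.frobeniusNormSq (fderiv ℝ (Literature.Analysis.FluidPDE.curl (W t)) x)) ≤ |∫ x, ⟪Literature.Analysis.FluidPDE.curl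 (W t) x, fderiv ℝ (W t) x (Literature.Analysis.FluidPDE.curl (W t) x)⟫_ℝ|) := stub_extremalPersistenceCompactness
  have hK1 : ¬ (∃ (W : ℝ → EuclideanSpace ℝ (Fin 3) → EuclideanSpace ℝ (Fin 3)) (a b : ℝ), (Literature.Analysis.FluidPDE.IsKNSSBlowupLimit W ∧ (∀ s t : ℝ, s < t → t < 0 → ∀ x, W t x = Literature.Analysis.FluidPDE.heatFlow (W s) (t - s) x - Literature.Analysis.FluidPDE.oseenDuhamel 1 s W W t x)) ∧ a < b ∧ b ≤ 0 ∧ ∀ᵐ t : ℝ, t ∈ Set.Ioo a b → (ContDiff ℝ (⊤ : ℕ∞) (W t) ∧ Literature.Analysis.FluidPDE.VectorCalculus.IsDivFree (W t) ∧ (∃ B : ℝ, ∀ x, ‖fderiv ℝ (W t) x‖ ≤ B) ∧ (∫⁻ x, ‖iteratedFDeriv ℝ 1 (W t) x‖ₑ ^ 2 < ⊤) ∧ (∫⁻ x, ‖iteratedFDeriv ℝ 2 (W t) x‖ₑ ^ 2 < ⊤) ∧ ∃ M : ℝ, (∀ x, ‖(W t) x‖ ≤ M) ∧ 0 < M * Real.sqrt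 (∫ x, ‖Literature.Analysis.FluidPDE.curl (W t) x‖ ^ 2) * Real.sqrt (∫ x, Literature.Analysis.FluidPDE.frobeniusNormSq (fderiv ℝ (Literature.Analysis.FluidPDE.curl (W t)) x)) ∧ (sInf {κ : ℝ | (∀ (v : EuclideanSpace ℝ (Fin 3) → EuclideanSpace ℝ (Fin 3)) (M B : ℝ), ContDiff ℝ (⊤ : ℕ∞) v → Literature.Analysis.FluidPDE.VectorCalculus.IsDivFree v → (∀ x, ‖v x‖ ≤ M) → (∀ x, ‖fderiv ℝ v x‖ ≤ B) → (∫⁻ x, ‖iteratedFDeriv ℝ 0 v x‖ₑ ^ 2 < ⊤) → (∫⁻ x, ‖iteratedFDeriv ℝ 1 v x‖ₑ ^ 2 < ⊤) → (∫⁻ x, ‖iteratedFDeriv ℝ 2 v x‖ₑ ^ 2 < ⊤) → |∫ x, ⟪Literature.Analysis.FluidPDE.curl v x, fderiv ℝ v x (Literature.Analysis.FluidPDE.curl v x)⟫_ℝ| ≤ κ * M * Real.sqrt (∫ x, ‖Literature.Analysis.FluidPDE.curl v x‖ ^ 2) * Real.sqrt (∫ x, Literature.Analysis.FluidPDE.frobeniusNormSq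 (fderiv ℝ (Literature.Analysis.FluidPDE.curl v) x)))}) * M * Real.sqrt (∫ x, ‖Literature.Analysis.FluidPDE.curl (W t) x‖ ^ 2) * Real.sqrt (∫ x, Literature.Analysis.FluidPDE.frobeniusNormSq (fderiv ℝ (Literature.Analysis.FluidPDE.curl (W t)) x)) ≤ |∫ x, ⟪Literature.Analysis.FluidPDE.curl (W t) x, fderiv ℝ (W t) x (Literature.Analysis.FluidPDE.curl (W t) x)⟫_ℝ|)) := extremalAncient_false_of analyticSlices noAnalyticExtremal
  have hnotP : ¬ (∀ β : ℝ, β < (sInf {κ : ℝ | (∀ (v : EuclideanSpace ℝ (Fin 3) → EuclideanSpace ℝ (Fin 3)) (M B : ℝ), ContDiff ℝ (⊤ : ℕ∞) v → Literature.Analysis.FluidPDE.VectorCalculus.IsDivFree v → (∀ x, ‖v x‖ ≤ M) → (∀ x, ‖fderiv ℝ v x‖ ≤ B) → (∫⁻ x, ‖iteratedFDeriv ℝ 0 v x‖ₑ ^ 2 < ⊤) → (∫⁻ x, ‖iteratedFDeriv ℝ 1 v x‖ₑ ^ 2 < ⊤) → (∫⁻ x, ‖iteratedFDeriv ℝ 2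 v x‖ₑ ^ 2 < ⊤) → |∫ x, ⟪Literature.Analysis.FluidPDE.curl v x, fderiv ℝ v x (Literature.Analysis.FluidPDE.curl v x)⟫_ℝ| ≤ κ * M * Real.sqrt (∫ x, ‖Literature.Analysis.FluidPDE.curl v x‖ ^ 2) * Real.sqrt (∫ x, Literature.Analysis.FluidPDE.frobeniusNormSq (fderiv ℝ (Literature.Analysis.FluidPDE.curl v) x)))}) ^ 2 → ∀ L : ℝ, 0 < L → ∃ (C ν T : ℝ) (u : ℝ → EuclideanSpace ℝ (Fin 3) → EuclideanSpace ℝ (Fin 3)) (p : ℝ → EuclideanSpace ℝ (Fin 3) → ℝ), 0 < C ∧ 0 < ν ∧ 0 < T ∧ Literature.Analysis.FluidPDE.IsClassicalNSSolutionOn (Set.Ico 0 T) ν 0 u p ∧ Literature.Analysis.FluidPDE.IsLerayHopfOn T ν 0 (u 0) u ∧ Literature.Analysis.FluidPDE.HasRapidSpatialDecay (u 0) ∧ (∀ᶠ t in 𝓝[<] T, ∀ x, Real.sqrt (T - t) * ‖u t x‖ ≤ C * Real.sqrt ν) ∧ ¬ Literature.Analysis.FluidPDE.HasSmoothExtensionPast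 ν 0 u T ∧ ∀ (k : ℝ → ℝ), Measurable k → (∀ τ, 0 ≤ k τ ∧ k τ ≤ 1) → (∀ t ∈ Set.Ico 0 T, ∀ M : ℝ, (∀ x, ‖u t x‖ ≤ M) → |∫ x, ⟪Literature.Analysis.FluidPDE.curl (u t) x, fderiv ℝ (u t) x (Literature.Analysis.FluidPDE.curl (u t) x)⟫_ℝ| ≤ k t * M * Real.sqrt (∫ x, ‖Literature.Analysis.FluidPDE.curl (u t) x‖ ^ 2) * Real.sqrt (∫ x, Literature.Analysis.FluidPDE.frobeniusNormSq (fderiv ℝ (Literature.Analysis.FluidPDE.curl (u t)) x))) → ∀ t₁ ∈ Set.Ico 0 T, ∃ s₁ s₂ : ℝ, t₁ ≤ s₁ ∧ s₁ < s₂ ∧ s₂ < T ∧ L ≤ Real.log ((T - s₁) / (T - s₂)) ∧ β * Real.log ((T - s₁) / (T - s₂)) < ∫ τ in s₁..s₂, k τ ^ 2 / (T - τ)) := fun hP => hK1 (hK2 hP)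
  -- Step 1: the uniform level β < κ⋆² and log-length L > 0.
  obtain ⟨β, hβ⟩ := not_forall.mp hnotP
  obtain ⟨hβlt, hβ2⟩ := Classical.not_imp.mp hβ
  obtain ⟨L, hL⟩ := not_forall.mp hβ2
  obtain ⟨hLpos, hrest⟩ := Classical.not_imp.mp hL
  -- constants of the sharp-constant API
  have hκgt : (13 : ℝ) / 200 < sInf {κ : ℝ | (∀ (v : EuclideanSpace ℝ (Fin 3) → EuclideanSpace ℝ (Fin 3)) (M B : ℝ), ContDiff ℝ (⊤ : ℕ∞) v → Literature.Analysis.FluidPDE.VectorCalculus.IsDivFree v → (∀ x, ‖v x‖ ≤ M) → (∀ x, ‖fderiv ℝ v x‖ ≤ B) → (∫⁻ x, ‖iteratedFDeriv ℝ 0 v x‖ₑ ^ 2 < ⊤) → (∫⁻ x, ‖iteratedFDeriv ℝ 1 v x‖ₑ ^ 2 < ⊤) → (∫⁻ x, ‖iteratedFDeriv ℝ 2 v x‖ₑ ^ 2 < ⊤) → |∫ x, ⟪Literature.Analysis.FluidPDE.curl v x, fderiv ℝ v x (Literature.Analysis.FluidPDE.curl v x)⟫_ℝ| ≤ κ * M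 * Real.sqrt (∫ x, ‖Literature.Analysis.FluidPDE.curl v x‖ ^ 2) * Real.sqrt (∫ x, Literature.Analysis.FluidPDE.frobeniusNormSq (fderiv ℝ (Literature.Analysis.FluidPDE.curl v) x)))} := sharpDepletion_gt
  have hκpos : (0 : ℝ) < sInf {κ : ℝ | (∀ (v : EuclideanSpace ℝ (Fin 3) → EuclideanSpace ℝ (Fin 3)) (M B : ℝ), ContDiff ℝ (⊤ : ℕ∞) v → Literature.Analysis.FluidPDE.VectorCalculus.IsDivFree v → (∀ x, ‖v x‖ ≤ M) → (∀ x, ‖fderiv ℝ v x‖ ≤ B) → (∫⁻ x, ‖iteratedFDeriv ℝ 0 v x‖ₑ ^ 2 < ⊤) → (∫⁻ x, ‖iteratedFDeriv ℝ 1 v x‖ₑ ^ 2 < ⊤) → (∫⁻ x, ‖iteratedFDeriv ℝ 2 v x‖ₑ ^ 2 < ⊤) → |∫ x, ⟪Literature.Analysis.FluidPDE.curl v x, fderiv ℝ v x (Literature.Analysis.FluidPDE.curl v x)⟫_ℝ| ≤ κ * M * Real.sqrt (∫ x, ‖Literature.Analysis.FluidPDE.curl v x‖ ^ 2) * Real.sqrt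 (∫ x, Literature.Analysis.FluidPDE.frobeniusNormSq (fderiv ℝ (Literature.Analysis.FluidPDE.curl v) x)))} := lt_trans (by norm_num) hκgt
  have hm0 : (0 : ℝ) ≤ max β 0 := le_max_right _ _
  have hA0 : (0 : ℝ) ≤ max β 0 * L := mul_nonneg hm0 hLpos.le
  refine ⟨Real.sqrt (max β 0) / sInf {κ : ℝ | (∀ (v : EuclideanSpace ℝ (Fin 3) → EuclideanSpace ℝ (Fin 3)) (M B : ℝ), ContDiff ℝ (⊤ : ℕ∞) v → Literature.Analysis.FluidPDE.VectorCalculus.IsDivFree v → (∀ x, ‖v x‖ ≤ M) → (∀ x, ‖fderiv ℝ v x‖ ≤ B) → (∫⁻ x, ‖iteratedFDeriv ℝ 0 v x‖ₑ ^ 2 < ⊤) → (∫⁻ x, ‖iteratedFDeriv ℝ 1 v x‖ₑ ^ 2 < ⊤) → (∫⁻ x, ‖iteratedFDeriv ℝ 2 v x‖ₑ ^ 2 < ⊤) → |∫ x, ⟪Literature.Analysis.FluidPDE.curl v x, fderiv ℝ v x (Literature.Analysis.FluidPDE.curl v x)⟫_ℝ| ≤ κ * M * Real.sqrt (∫ x,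 ‖Literature.Analysis.FluidPDE.curl v x‖ ^ 2) * Real.sqrt (∫ x, Literature.Analysis.FluidPDE.frobeniusNormSq (fderiv ℝ (Literature.Analysis.FluidPDE.curl v) x)))}, div_nonneg (Real.sqrt_nonneg _) hκpos.le, ?_, ?_⟩
  · rw [div_lt_one hκpos, Real.sqrt_lt' hκpos]
    exact max_lt hβlt (by positivity)
  intro κ hκ C ν T hC hν hT u p hcl hLH hdec hrate hsing
  have hκle : sInf {κ : ℝ | (∀ (v : EuclideanSpace ℝ (Fin 3) → EuclideanSpace ℝ (Fin 3)) (M B : ℝ), ContDiff ℝ (⊤ : ℕ∞) v → Literature.Analysis.FluidPDE.VectorCalculus.IsDivFree v → (∀ x, ‖v x‖ ≤ M) → (∀ x, ‖fderiv ℝ v x‖ ≤ B) → (∫⁻ x, ‖iteratedFDeriv ℝ 0 v x‖ₑ ^ 2 < ⊤) → (∫⁻ x, ‖iteratedFDeriv ℝ 1 v x‖ₑ ^ 2 < ⊤) → (∫⁻ x, ‖iteratedFDeriv ℝ 2 v x‖ₑ ^ 2 < ⊤) → |∫ x, ⟪Literature.Analysis.FluidPDE.curl v x, fderiv ℝ v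 x (Literature.Analysis.FluidPDE.curl v x)⟫_ℝ| ≤ κ * M * Real.sqrt (∫ x, ‖Literature.Analysis.FluidPDE.curl v x‖ ^ 2) * Real.sqrt (∫ x, Literature.Analysis.FluidPDE.frobeniusNormSq (fderiv ℝ (Literature.Analysis.FluidPDE.curl v) x)))} ≤ κ := sharpDepletion_le hκ
  -- Step 2: along this flow, some admissible coefficient k and onset t₁ have only subextremal long windows.
  have hk : ¬ (∀ (k : ℝ → ℝ), Measurable k → (∀ τ, 0 ≤ k τ ∧ k τ ≤ 1) → (∀ t ∈ Set.Ico 0 T, ∀ M : ℝ, (∀ x, ‖u t x‖ ≤ M) → |∫ x, ⟪Literature.Analysis.FluidPDE.curl (u t) x, fderiv ℝ (u t) x (Literature.Analysis.FluidPDE.curl (u t) x)⟫_ℝ| ≤ k t * M * Real.sqrt (∫ x, ‖Literature.Analysis.FluidPDE.curl (u t) x‖ ^ 2) * Real.sqrt (∫ x, Literature.Analysis.FluidPDE.frobeniusNormSq (fderiv ℝ (Literature.Analysis.FluidPDE.curl (u t)) x))) → ∀ t₁ ∈ Set.Ico 0 T, ∃ s₁ s₂ : ℝ, t₁ ≤ s₁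 ∧ s₁ < s₂ ∧ s₂ < T ∧ L ≤ Real.log ((T - s₁) / (T - s₂)) ∧ β * Real.log ((T - s₁) / (T - s₂)) < ∫ τ in s₁..s₂, k τ ^ 2 / (T - τ)) := fun hall =>
    hrest ⟨C, ν, T, u, p, hC, hν, hT, hcl, hLH, hdec, hrate, hsing, hall⟩
  obtain ⟨k, hk1⟩ := not_forall.mp hk
  obtain ⟨hkm, hk2⟩ := Classical.not_imp.mp hk1
  obtain ⟨hk01, hk3⟩ := Classical.not_imp.mp hk2
  obtain ⟨hclause, hk4⟩ := Classical.not_imp.mp hk3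
  obtain ⟨t₁, ht₁'⟩ := not_forall.mp hk4
  obtain ⟨ht₁, hnowin⟩ := Classical.not_imp.mp ht₁'
  have hwin : ∀ s₁ s₂ : ℝ, t₁ ≤ s₁ → s₁ < s₂ → s₂ < T → L ≤ Real.log ((T - s₁) / (T - s₂)) →
      ∫ τ in s₁..s₂, k τ ^ 2 / (T - τ) ≤ β * Real.log ((T - s₁) / (T - s₂)) :=
    fun s₁ s₂ h1 h2 h3 h4 => not_lt.mp fun hlt => hnowin ⟨s₁, s₂, h1, h2, h3, h4, hlt⟩
  have hTt₁ : 0 < T - t₁ := sub_pos.mpr ht₁.2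
  -- Step 3: geometric blocks of log-length exactly L carry mass ≤ max β 0 · L.
  have hblock : ∀ n : ℕ, ∫ τ in (T - (T - t₁) * Real.exp (-(n * L)))..(T - (T - t₁) * Real.exp (-((n + 1) * L))), k τ ^ 2 / (T - τ) ≤ max β 0 * L := by
    intro n
    have hn : (0 : ℝ) ≤ n := n.cast_nonneg
    have he1 : Real.exp (-(n * L)) ≤ 1 := by
      rw [Real.exp_le_one_iff]
      have := mul_nonneg hn hLpos.le
      linarith
    have he2 : Real.exp (-((n + 1) * L)) < Real.exp (-(n * L)) := by
      rw [Real.exp_lt_exp]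
      have : ((n : ℝ) + 1) * L = n * L + L := by ring
      rw [this]
      linarith
    have h1 : t₁ ≤ (T - (T - t₁) * Real.exp (-(n * L))) := by
      have := mul_le_mul_of_nonneg_left he1 hTt₁.le
      linarith
    have h2 : (T - (T - t₁) * Real.exp (-(n * L))) < (T - (T - t₁) * Real.exp (-((n + 1) * L))) := by
      have := mul_lt_mul_of_pos_left he2 hTt₁
      linarith
    have h3 : (T - (T - t₁) * Real.exp (-((n + 1) * L))) < T := by
      have := mul_pos hTt₁ (Real.exp_pos (-((n + 1) * L)))
      linarith
    have hratio : (T - (T - (T - t₁) * Real.exp (-(n * L)))) / (T - (T - (T - t₁) * Real.exp (-((n + 1) * L)))) = Real.exp L := by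
      rw [show T - (T - (T - t₁) * Real.exp (-(n * L))) = (T - t₁) * Real.exp (-(n * L)) by ring,
        show T - (T - (T - t₁) * Real.exp (-((n + 1) * L))) = (T - t₁) * Real.exp (-((n + 1) * L)) by ring,
        mul_div_mul_left _ _ hTt₁.ne', ← Real.exp_sub]
      congr 1
      ring
    have hlog : Real.log ((T - (T - (T - t₁) * Real.exp (-(n * L)))) / (T - (T - (T - t₁) * Real.exp (-((n + 1) * L))))) = L := by
      rw [hratio, Real.log_exp]
    have hw := hwin (T - (T - t₁) * Real.exp (-(n * L))) (T - (T - t₁) * Real.exp (-((n + 1) * L))) h1 h2 h3 (le_of_eq hlog.symm)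
    rw [hlog] at hw
    exact hw.trans (mul_le_mul_of_nonneg_right (le_max_left _ _) hLpos.le)
  -- Step 4: sum the blocks (tree lemma) and restrict the flow-wise clause to [t₁, T).
  have hmain := blocksToLog_general (g := fun τ => k τ ^ 2 / (T - τ)) (t₁ := t₁) (T := T) (A := max β 0 * L) (ℓ := L)
    ht₁.2 hA0 hLpos (fun τ hτ => div_nonneg (sq_nonneg _) (sub_nonneg.mpr (le_of_lt hτ.2)))
    (fun t ht => intervalIntegrable_coeff_sq_div hkm hk01 ht.1 ht.2) hblock
  refine ⟨t₁, ht₁, k, max β 0 * L, hkm, hk01, fun t ht M hM => hclause t ⟨ht₁.1.trans ht.1, ht.2⟩ M hM, fun t ht => ?_⟩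
  have h := hmain t ht
  have hlog0 : 0 ≤ Real.log ((T - t₁) / (T - t)) := by
    apply Real.log_nonneg
    rw [le_div_iff₀ (sub_pos.mpr ht.2)]
    linarith [ht.1]
  have hcoef : max β 0 * L / L ≤ (Real.sqrt (max β 0) / sInf {κ : ℝ | (∀ (v : EuclideanSpace ℝ (Fin 3) → EuclideanSpace ℝ (Fin 3)) (M B : ℝ), ContDiff ℝ (⊤ : ℕ∞) v → Literature.Analysis.FluidPDE.VectorCalculus.IsDivFree v → (∀ x, ‖v x‖ ≤ M) → (∀ x, ‖fderiv ℝ v x‖ ≤ B) → (∫⁻ x, ‖iteratedFDeriv ℝ 0 v x‖ₑ ^ 2 < ⊤) → (∫⁻ x, ‖iteratedFDeriv ℝ 1 v x‖ₑ ^ 2 < ⊤) → (∫⁻ x, ‖iteratedFDeriv ℝ 2 v x‖ₑ ^ 2 < ⊤) → |∫ x, ⟪Literature.Analysis.FluidPDE.curl v x, fderiv ℝ v x (Literature.Analysis.FluidPDE.curl v x)⟫_ℝ| ≤ κ * M * Real.sqrt (∫ x, ‖Literature.Analysis.FluidPDE.curl v x‖ ^ 2) * Real.sqrt (∫ x, Literature.Analysis.FluidPDE.frobeniusNormSq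 (fderiv ℝ (Literature.Analysis.FluidPDE.curl v) x)))} * κ) ^ 2 := by
    rw [mul_div_assoc, div_self hLpos.ne', mul_one, div_mul_eq_mul_div, div_pow, mul_pow, Real.sq_sqrt hm0,
      le_div_iff₀ (pow_pos hκpos 2)]
    exact mul_le_mul_of_nonneg_left (pow_le_pow_left₀ hκpos.le hκle 2) hm0
  exact h.trans (add_le_add (mul_le_mul_of_nonneg_right hcoef hlog0) le_rfl)

-- audit: the composition concludes the crux BY NAME; sorries only in the four stubs (T, F, K2, K1a); E is proved.
#print axioms boundedPotentialIdentity_holds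

#print axioms NearExtremalTransience_of

#print axioms noAxialResidueObject_of

#print axioms noAnalyticExtremal

end Summit.NavierStokesRegularity.NavierStokesRegularity.Cruxes.NearExtremalTransience.L2Budget
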